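import Literature.Topology.FourManifolds.ConeGeometry
import HarnessLib

/-!
# The scaling family: contracting the southern content of the spiked knot

Topic `Literature/Topology/FourManifolds` (trunk T-4MAN). Fact seat
`provefact-Literature.Topology.FourManifolds.Knot.IsConnectedSum.isIsotopic` (Schubert's theorem),
stage S1 of the proof of the geometric heart for rail knots (PIPELINE v6, STEP 1). The southern
content of the spiked knot (`ConeGeometry.contentSet`: everything beyond the blown-up parameter
`3/8` on the two straight spikes) is contracted towards the centre `oS` by the homothety of ratio
`λ` in the chart `ψ`, the straight spikes being reparametrised so as to stay straight; this is a
smooth one-parameter family of simple regular loops (the **scaling family**), whence an isotopy of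
knots by the modification lemma of `CurveFamilyIsotopy.lean`. Embeddedness of the family is the
cone condition `ConeGeometry.cone` (content chords avoid the walls) together with an elementary
analysis of the content against itself.

Contents: the scalar profiles (`spikeWin`, `regionCut`, the window product, the region cut-off,
the scale function `Λ u s = 1 - windowProd s · u (1 - λ₀) ∈ [λ₀, 1]`); the **extended region**
(`αLo, αHi ≥ 1/4`: flat pieces or content, never the north pole — `region_cases`,
`knotPt_ne_northPole`); the family `b.scalePiece H.cone lam₀ u` = spiked piece + region-cut
difference, with: agreement with the spiked piece function off the content set
(`scalePiece_eq_of_not_mem`) and at `u = 0` (`scalePiece_zero`), the closed form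
`ψ⁻¹ (oS + Λ (Y - oS))` on the extended region (`scalePiece_eq_of_region`), unit norm, joint
smoothness (`contDiff_scalePiece`), regularity on the content set (`deriv_scalePiece_ne_zero`: on the
straight spikes the scaled chart point is `oS + ψ_c(α) (base - oS)` with the strictly decreasing
**spike scalar** `ψ_c`, elsewhere it is the homothety image of the regular chart value),
injectivity on the content set (`injOn_scalePiece`: spike/spike by monotonicity, spike/general by the
return step and the flat first coordinate, far content by depth, general/general by injectivity of
the spiked knot), and disjointness from the walls (`scalePiece_ne_spikePiece` = the cone condition).
Whence the **shrink scale** hypotheses `BandData.ShrinkScale` (`exists_shrinkScale`: they hold for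
all small `κ`, for every ratio `λ₀ ∈ (0, 1]`), the **shrunk knot** `b.shrinkKnot H hA hB hAB` and the
isotopies `isIsotopic_spikeKnot_shrinkKnot`, `isIsotopic_railKnot_shrinkKnot`.

Everything is proved; no named facts are introduced.

## References

* M. W. Hirsch, *Differential Topology*, GTM 33, Springer (1976), Ch. 8 §1, Thm. 1.3.
  [HirschDT1976]
-/

open scoped Manifold ContDiff Topology Real
open Function Set Metric Filter

noncomputable section

namespace Literature.Topology.FourManifolds

/-- Local notation: `𝔼 n` is the model Euclidean space `EuclideanSpace ℝ (Fin n)`. -/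
local notation "𝔼 " n:arg => EuclideanSpace ℝ (Fin n)

/-- Local notation: `𝕊 n` is the unit sphere in `EuclideanSpace ℝ (Fin (n + 1))`. -/
local notation "𝕊 " n:arg => (Metric.sphere (0 : EuclideanSpace ℝ (Fin (n + 1))) 1)

attribute [local instance] fact_finrank_euclideanSpace_succ

open KnotsInBall

/-! ### The scalar profiles -/

/-- **The spike window** `γ = smoothStep (7/16) (11/16)`: `0` left of `7/16`, `1` right of `11/16`.
[folklore] -/
def spikeWin (α : ℝ) : ℝ := smoothStep (7 / 16) (11 / 16) α

/-- **The region cut-off** `σ₁ = smoothStep (1/4) (3/8)`: `0` left of `1/4`, `1` right of `3/8`.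
[folklore] -/
def regionCut (α : ℝ) : ℝ := smoothStep (1 / 4) (3 / 8) α

/-- `γ` is `C^∞`. [folklore] -/
theorem contDiff_spikeWin : ContDiff ℝ ∞ spikeWin := contDiff_smoothStep _ _

/-- `σ₁` is `C^∞`. [folklore] -/
theorem contDiff_regionCut : ContDiff ℝ ∞ regionCut := contDiff_smoothStep _ _

/-- `γ ∈ [0, 1]`. [folklore] -/
theorem spikeWin_mem_Icc (α : ℝ) : spikeWin α ∈ Icc (0 : ℝ) 1 := smoothStep_mem_Icc _ _ _

/-- `σ₁ ∈ [0, 1]`. [folklore] -/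
theorem regionCut_mem_Icc (α : ℝ) : regionCut α ∈ Icc (0 : ℝ) 1 := smoothStep_mem_Icc _ _ _

/-- `γ = 0` left of `7/16`. [folklore] -/
theorem spikeWin_eq_zero {α : ℝ} (h : α ≤ 7 / 16) : spikeWin α = 0 := smoothStep_of_le (by norm_num) h

/-- `γ = 1` right of `11/16`. [folklore] -/
theorem spikeWin_eq_one {α : ℝ} (h : 11 / 16 ≤ α) : spikeWin α = 1 := smoothStep_of_ge (by norm_num) h

/-- `σ₁ = 0` left of `1/4`. [folklore] -/
theorem regionCut_eq_zero {α : ℝ} (h : α ≤ 1 / 4) : regionCut α = 0 := smoothStep_of_le (by norm_num) h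

/-- `σ₁ = 1` right of `3/8`. [folklore] -/
theorem regionCut_eq_one {α : ℝ} (h : 3 / 8 ≤ α) : regionCut α = 1 := smoothStep_of_ge (by norm_num) h

/-- `σ₁ ≠ 0` forces `α > 1/4`. [folklore] -/
theorem lt_of_regionCut_ne_zero {α : ℝ} (h : regionCut α ≠ 0) : 1 / 4 < α :=
  not_le.1 fun hle ↦ h (regionCut_eq_zero hle)

namespace BandData

variable {A B K : Knot} {avoid : Set (𝕊 3)} (b : BandData A B K avoid)
  {hcross : b.band ⁻¹' sphereEquator 2 ∩ squareNhd b.δ = {x ∈ squareNhd b.δ | x 0 = 2⁻¹}}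
  {ε r A' κ : ℝ} (h : b.ConeScale hcross ε r A' κ)

/-! ### The window product, the region cut-off and the scale function -/

/-- **The window product** `γ(αLo s) γ(αHi s)`: `1` on the general content, `γ` of the blown-up
parameter on each straight spike. [folklore] -/
def windowProd (κ : ℝ) (s : ℝ) : ℝ := spikeWin (b.alphaLo κ s) * spikeWin (b.alphaHi κ s)

/-- **The region cut-off** `σ₁(αLo s) σ₁(αHi s)`: `1` on the content set, `0` off the extended
region. [folklore] -/
def regionTheta (κ : ℝ) (s : ℝ) : ℝ := regionCut (b.alphaLo κ s) * regionCut (b.alphaHi κ s)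

/-- **The scale function** `Λ u s = 1 - windowProd s · u (1 - λ₀)`. [folklore] -/
def scaleFn (κ lam₀ u s : ℝ) : ℝ := 1 - b.windowProd κ s * (u * (1 - lam₀))

/-- The window product is `C^∞`. [folklore] -/
theorem contDiff_windowProd (κ : ℝ) : ContDiff ℝ ∞ (b.windowProd κ) :=
  (contDiff_spikeWin.comp (b.contDiff_alphaLo κ)).mul (contDiff_spikeWin.comp (b.contDiff_alphaHi κ))

/-- The region cut-off is `C^∞`. [folklore] -/
theorem contDiff_regionTheta (κ : ℝ) : ContDiff ℝ ∞ (b.regionTheta κ) :=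
  (contDiff_regionCut.comp (b.contDiff_alphaLo κ)).mul (contDiff_regionCut.comp (b.contDiff_alphaHi κ))

/-- The scale function is jointly `C^∞` in `(u, s)`. [folklore] -/
theorem contDiff_scaleFn (κ lam₀ : ℝ) : ContDiff ℝ ∞ (uncurry (b.scaleFn κ lam₀)) :=
  contDiff_const.sub (((b.contDiff_windowProd κ).comp contDiff_snd).mul ((contDiff_fst.mul contDiff_const)))

/-- The window product lies in `[0, 1]`. [folklore] -/
theorem windowProd_mem_Icc (κ s : ℝ) : b.windowProd κ s ∈ Icc (0 : ℝ) 1 := by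
  have h1 := spikeWin_mem_Icc (b.alphaLo κ s); have h2 := spikeWin_mem_Icc (b.alphaHi κ s)
  rw [windowProd]
  exact ⟨mul_nonneg h1.1 h2.1, mul_le_one₀ h1.2 h2.1 h2.2⟩

/-- The region cut-off lies in `[0, 1]`. [folklore] -/
theorem regionTheta_mem_Icc (κ s : ℝ) : b.regionTheta κ s ∈ Icc (0 : ℝ) 1 := by
  have h1 := regionCut_mem_Icc (b.alphaLo κ s); have h2 := regionCut_mem_Icc (b.alphaHi κ s)
  rw [regionTheta]
  exact ⟨mul_nonneg h1.1 h2.1, mul_le_one₀ h1.2 h2.1 h2.2⟩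

/-- **The scale function lies in `[λ₀, 1]`** for `u ∈ [0, 1]` and `λ₀ ∈ [0, 1]`. [folklore] -/
theorem scaleFn_mem_Icc {lam₀ u : ℝ} (hl : lam₀ ∈ Icc (0 : ℝ) 1) (hu : u ∈ Icc (0 : ℝ) 1) (κ s : ℝ) :
    b.scaleFn κ lam₀ u s ∈ Icc lam₀ 1 := by
  have hw := b.windowProd_mem_Icc κ s
  rw [scaleFn]
  have hp : 0 ≤ b.windowProd κ s * u := mul_nonneg hw.1 hu.1
  have hp1 : b.windowProd κ s * u ≤ 1 := mul_le_one₀ hw.2 hu.1 hu.2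
  have e : b.windowProd κ s * (u * (1 - lam₀)) = (b.windowProd κ s * u) * (1 - lam₀) := by ring
  rw [e]
  constructor <;> nlinarith [hl.1, hl.2]

/-- The scale function lies in `[0, 1]`. [folklore] -/
theorem scaleFn_mem_Icc01 {lam₀ u : ℝ} (hl : lam₀ ∈ Icc (0 : ℝ) 1) (hu : u ∈ Icc (0 : ℝ) 1) (κ s : ℝ) :
    b.scaleFn κ lam₀ u s ∈ Icc (0 : ℝ) 1 :=
  ⟨hl.1.trans (b.scaleFn_mem_Icc hl hu κ s).1, (b.scaleFn_mem_Icc hl hu κ s).2⟩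

/-- At `u = 0` the scale function is `1`. [folklore] -/
@[simp] theorem scaleFn_zero (κ lam₀ s : ℝ) : b.scaleFn κ lam₀ 0 s = 1 := by simp [scaleFn]

/-- Where the window product vanishes the scale function is `1`. [folklore] -/
theorem scaleFn_of_windowProd_eq_zero {κ s : ℝ} (hw : b.windowProd κ s = 0) (lam₀ u : ℝ) : b.scaleFn κ lam₀ u s = 1 := by
  simp [scaleFn, hw]

/-- Left of `7/16` on the lower spike the window product vanishes. [folklore] -/
theorem windowProd_eq_zero_of_alphaLo_le {κ s : ℝ} (hα : b.alphaLo κ s ≤ 7 / 16) : b.windowProd κ s = 0 := by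
  simp [windowProd, spikeWin_eq_zero hα]

/-- Left of `7/16` on the upper spike the window product vanishes. [folklore] -/
theorem windowProd_eq_zero_of_alphaHi_le {κ s : ℝ} (hα : b.alphaHi κ s ≤ 7 / 16) : b.windowProd κ s = 0 := by
  simp [windowProd, spikeWin_eq_zero hα]

/-- Where both blown-up parameters are `≥ 11/16` the window product is `1`. [folklore] -/
theorem windowProd_eq_one {κ s : ℝ} (h1 : 11 / 16 ≤ b.alphaLo κ s) (h2 : 11 / 16 ≤ b.alphaHi κ s) : b.windowProd κ s = 1 := by
  simp [windowProd, spikeWin_eq_one h1, spikeWin_eq_one h2]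

/-- Where both blown-up parameters are `≥ 3/8` the region cut-off is `1`. [folklore] -/
theorem regionTheta_eq_one {κ s : ℝ} (h1 : 3 / 8 ≤ b.alphaLo κ s) (h2 : 3 / 8 ≤ b.alphaHi κ s) : b.regionTheta κ s = 1 := by
  simp [regionTheta, regionCut_eq_one h1, regionCut_eq_one h2]

/-- Where the region cut-off is nonzero both blown-up parameters exceed `1/4`. [folklore] -/
theorem alpha_gt_of_regionTheta_ne_zero {κ s : ℝ} (hθ : b.regionTheta κ s ≠ 0) :
    1 / 4 < b.alphaLo κ s ∧ 1 / 4 < b.alphaHi κ s := by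
  rw [regionTheta, mul_ne_zero_iff] at hθ
  exact ⟨lt_of_regionCut_ne_zero hθ.1, lt_of_regionCut_ne_zero hθ.2⟩

include h

/-! ### The extended region: both blown-up parameters exceed `1/4` -/

/-- On the closed lower core the upper blown-up parameter is `≥ 6`. [folklore] -/
theorem six_le_alphaHi_of_coreLo {s : ℝ} (hs : s ≤ b.thi) : 6 ≤ b.alphaHi κ s := by
  have hκ := h.spike.κ_pos
  have hκ12 := h.spike.κ_le
  have hε' := b.epsHi_bounds.1
  have hχ : b.chiHi s = 1 := smoothStep_of_ge (by linarith [b.cUp_hyp.1, b.cUp_hyp.2.1]) (by linarith)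
  rw [alphaHi, hχ, le_div_iff₀ hκ]; linarith

/-- On the closed upper core the lower blown-up parameter is `≥ 6`. [folklore] -/
theorem six_le_alphaLo_of_coreHi {s : ℝ} (hs : b.tlo ≤ s) : 6 ≤ b.alphaLo κ s := by
  have hκ := h.spike.κ_pos
  have hκ12 := h.spike.κ_le
  have hε := b.epsLo_bounds.1
  have hχ : b.chiLo s = 1 := smoothStep_of_ge (by linarith [b.cLo_hyp.1, b.cLo_hyp.2.1]) (by linarith)
  rw [alphaLo, hχ, le_div_iff₀ hκ]; linarith

/-- **Localisation of the extended region**: `αLo s > 1/4` and `αHi s > 1/4` (for `s` in the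
fundamental domain) put `s` either in the open lower core with `αLo s < 7`, or strictly between
`tcLo` and `tcHi`, or in the open upper core with `αHi s < 7`; in all cases
`tcLo - epsLo/8 < s < tcHi + epsHi/8`. [folklore] -/
theorem mem_Ioo_of_alpha_gt {s : ℝ} (h1 : 1 / 4 ≤ b.alphaLo κ s) (h2 : 1 / 4 ≤ b.alphaHi κ s) :
    s ∈ Ioo (b.tcLo - b.epsLo / 8) (b.tcHi + b.epsHi / 8) := by
  have hκ := h.spike.κ_pos
  have h7 := h.spike.seven_le_gapLo
  have h7' := h.spike.seven_le_gapHi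
  constructor
  · by_contra hle
    push Not at hle
    -- `s ≤ tcLo - ε/8`: `χ₁ s ≤ 1/2 - gapLo`, so `αLo s ≤ -7`
    have hχ : b.chiLo s ≤ b.chiLo (b.tcLo - b.epsLo / 8) := b.monotone_chiLo hle
    have hg : b.gapLo ≤ 1 / 2 - b.chiLo (b.tcLo - b.epsLo / 8) := min_le_right _ _
    have := b.mul_alphaLo hκ.ne' s
    nlinarith
  · by_contra hle
    push Not at hle
    have hχ : b.chiHi s ≤ b.chiHi (b.tcHi + b.epsHi / 8) := b.antitone_chiHi hle
    have hg : b.gapHi ≤ 1 / 2 - b.chiHi (b.tcHi + b.epsHi / 8) := min_le_right _ _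
    have := b.mul_alphaHi hκ.ne' s
    nlinarith

/-- **In the extended region the knot point is a flat piece or a content point; in particular it
is not the north pole.** Precisely: either `s` is in the closed lower core with
`1/4 < αLo s`, `κ (|αLo s| + 1) < r` and knot point `ψ⁻¹ (pieceLo 1 (αLo s))`, or the same on the
upper core, or `s ∈ contentSet`. [folklore] -/
theorem region_cases {s : ℝ} (h1 : 1 / 4 ≤ b.alphaLo κ s) (h2 : 1 / 4 ≤ b.alphaHi κ s) :
    (s ∈ Icc (b.tcLo - b.epsLo / 8) (b.tcLo + b.epsLo / 8) ∧ κ * (|b.alphaLo κ s| + 1) < r ∧ b.alphaLo κ s < 3 / 8 ∧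
        b.knotPt h s = psiN.symm (b.pieceLo hcross κ b.depthSign 1 (b.alphaLo κ s))) ∨
      (s ∈ Icc (b.tcHi - b.epsHi / 8) (b.tcHi + b.epsHi / 8) ∧ κ * (|b.alphaHi κ s| + 1) < r ∧ b.alphaHi κ s < 3 / 8 ∧
        b.knotPt h s = psiN.symm (b.pieceHi hcross κ b.depthSign 1 (b.alphaHi κ s))) ∨
      s ∈ b.contentSet h.spike.κ_pos h.spike.seven_le_gapLo h.spike.seven_le_gapHi := by
  have hκ := h.spike.κ_pos
  have h8 := h.spike.eight_lt_r
  obtain ⟨hs1, hs2⟩ := b.mem_Ioo_of_alpha_gt h h1 h2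
  have hjl := b.juncLo_spec hκ h.spike.seven_le_gapLo
  have hjh := b.juncHi_spec hκ h.spike.seven_le_gapHi
  by_cases hc : s ∈ b.contentSet h.spike.κ_pos h.spike.seven_le_gapLo h.spike.seven_le_gapHi
  · exact Or.inr (Or.inr hc)
  rw [contentSet, mem_Icc, not_and_or, not_le, not_le] at hc
  rcases hc with hlt | hgt
  · -- `s < juncLo ≤ tcLo + ε/8`: closed lower core, `αLo < 3/8`
    have hsc : s ∈ Icc (b.tcLo - b.epsLo / 8) (b.tcLo + b.epsLo / 8) := ⟨hs1.le, by linarith [hjl.1.2]⟩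
    have hα : b.alphaLo κ s < 3 / 8 := b.alphaLo_lt_of_lt_juncLo hκ h.spike.seven_le_gapLo hsc hlt
    have hflat : κ * (|b.alphaLo κ s| + 1) < r := by
      rw [abs_of_nonneg (by linarith)]; nlinarith
    refine Or.inl ⟨hsc, hflat, hα, ?_⟩
    exact (b.Ypt_eq_of_eq h (b.spikePiece_one_coreLo h.spike hsc (norm_railLoParam_lt hκ hflat))).1
  · have hsc : s ∈ Icc (b.tcHi - b.epsHi / 8) (b.tcHi + b.epsHi / 8) := ⟨by linarith [hjh.1.1], hs2.le⟩
    have hα : b.alphaHi κ s < 3 / 8 := b.alphaHi_lt_of_juncHi_lt hκ h.spike.seven_le_gapHi hsc hgt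
    have hflat : κ * (|b.alphaHi κ s| + 1) < r := by
      rw [abs_of_nonneg (by linarith)]; nlinarith
    refine Or.inr (Or.inl ⟨hsc, hflat, hα, ?_⟩)
    exact (b.Ypt_eq_of_eq h (b.spikePiece_one_coreHi h.spike hsc (norm_railHiParam_lt hκ hflat))).1

/-- **In the extended region the knot point is not the north pole.** [folklore] -/
theorem knotPt_ne_northPole (hB : B.InSouth) {s : ℝ} (h1 : 1 / 4 ≤ b.alphaLo κ s) (h2 : 1 / 4 ≤ b.alphaHi κ s) :
    b.knotPt h s ≠ northPole := by
  rcases b.region_cases h h1 h2 with ⟨-, -, -, he⟩ | ⟨-, -, -, he⟩ | hc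
  · rw [he]; exact psiN_symm_ne_northPole _
  · rw [he]; exact psiN_symm_ne_northPole _
  · rcases b.content_cases h hc with ⟨-, -, -, he, -⟩ | ⟨-, -, -, he, -⟩ | hfar
    · rw [he]; exact psiN_symm_ne_northPole _
    · rw [he]; exact psiN_symm_ne_northPole _
    · exact ne_northPole_of_nonpos (b.farSouth_last_neg hcross hB (b.farThreshold_pos h) hfar).le

/-- On the content set both blown-up parameters are `≥ 3/8`. [folklore] -/
theorem alpha_ge_of_mem_contentSet {s : ℝ} (hs : s ∈ b.contentSet h.spike.κ_pos h.spike.seven_le_gapLo h.spike.seven_le_gapHi) :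
    3 / 8 ≤ b.alphaLo κ s ∧ 3 / 8 ≤ b.alphaHi κ s := by
  have hκ := h.spike.κ_pos
  have hjl := b.juncLo_spec hκ h.spike.seven_le_gapLo
  have hjh := b.juncHi_spec hκ h.spike.seven_le_gapHi
  have hm := b.marks_lt
  obtain ⟨hw1, hw2, -⟩ := b.tcLo_window
  obtain ⟨hw3, hw4, -⟩ := b.tcHi_window
  constructor
  · rcases le_or_gt s (b.tcLo + b.epsLo / 8) with h1 | h1
    · exact b.le_alphaLo_of_juncLo_le hκ h.spike.seven_le_gapLo ⟨by linarith [hs.1, hjl.1.1, b.epsLo_bounds.1], h1⟩ hs.1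
    · -- beyond the lower core: `αLo ≥ 7`
      have hχ : b.chiLo (b.tcLo + b.epsLo / 8) ≤ b.chiLo s := b.monotone_chiLo h1.le
      have hg : b.gapLo ≤ b.chiLo (b.tcLo + b.epsLo / 8) - 1 / 2 := min_le_left _ _
      have := b.mul_alphaLo hκ.ne' s
      nlinarith [h.spike.seven_le_gapLo]
  · rcases lt_or_ge s (b.tcHi - b.epsHi / 8) with h1 | h1
    · have hχ : b.chiHi (b.tcHi - b.epsHi / 8) ≤ b.chiHi s := b.antitone_chiHi h1.le
      have hg : b.gapHi ≤ b.chiHi (b.tcHi - b.epsHi / 8) - 1 / 2 := min_le_left _ _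
      have := b.mul_alphaHi hκ.ne' s
      nlinarith [h.spike.seven_le_gapHi]
    · exact b.le_alphaHi_of_le_juncHi hκ h.spike.seven_le_gapHi ⟨h1, by linarith [hs.2, hjh.1.2, b.epsHi_bounds.1]⟩ hs.2

/-- The region cut-off is `1` on the content set. [folklore] -/
theorem regionTheta_eq_one_of_mem {s : ℝ} (hs : s ∈ b.contentSet h.spike.κ_pos h.spike.seven_le_gapLo h.spike.seven_le_gapHi) :
    b.regionTheta κ s = 1 :=
  b.regionTheta_eq_one (b.alpha_ge_of_mem_contentSet h hs).1 (b.alpha_ge_of_mem_contentSet h hs).2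

/-- **Off the content set, in the extended region, the window product vanishes.** [folklore] -/
theorem windowProd_eq_zero_of_not_mem {s : ℝ} (h1 : 1 / 4 ≤ b.alphaLo κ s) (h2 : 1 / 4 ≤ b.alphaHi κ s)
    (hs : s ∉ b.contentSet h.spike.κ_pos h.spike.seven_le_gapLo h.spike.seven_le_gapHi) : b.windowProd κ s = 0 := by
  rcases b.region_cases h h1 h2 with ⟨-, -, hα, -⟩ | ⟨-, -, hα, -⟩ | hc
  · exact b.windowProd_eq_zero_of_alphaLo_le (by linarith)
  · exact b.windowProd_eq_zero_of_alphaHi_le (by linarith)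
  · exact absurd hc hs

/-! ### The scaled chart point and the scaling family -/

/-- **The scaled chart point** `Z u s = oS + Λ u s (Y s - oS)`. [folklore] -/
def scalePt (lam₀ u s : ℝ) : 𝔼 3 :=
  b.oS hcross κ b.depthSign + b.scaleFn κ lam₀ u s • (b.Ypt h s - b.oS hcross κ b.depthSign)

/-- **The scaling family** of piece functions: the spiked piece function plus the region-cut
difference `ψ⁻¹ (Z u s) - (spiked piece)`. [folklore] -/
def scalePiece (lam₀ u s : ℝ) : 𝔼 4 :=
  b.spikePiece hcross κ b.depthSign 1 s +
    b.regionTheta κ s • (((psiN.symm (b.scalePt h lam₀ u s) : 𝕊 3) : 𝔼 4) - b.spikePiece hcross κ b.depthSign 1 s)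

/-- At `u = 0` the scaled chart point is the chart value. [folklore] -/
theorem scalePt_zero (lam₀ s : ℝ) : b.scalePt h lam₀ 0 s = b.Ypt h s := by
  simp [scalePt]

/-- Where the window product vanishes the scaled chart point is the chart value. [folklore] -/
theorem scalePt_of_windowProd_eq_zero {s : ℝ} (hw : b.windowProd κ s = 0) (lam₀ u : ℝ) : b.scalePt h lam₀ u s = b.Ypt h s := by
  simp [scalePt, b.scaleFn_of_windowProd_eq_zero hw]

/-- In the extended region, `ψ⁻¹` of the chart value is the knot point. [folklore] -/
theorem psiN_symm_Ypt' (hB : B.InSouth) {s : ℝ} (h1 : 1 / 4 ≤ b.alphaLo κ s) (h2 : 1 / 4 ≤ b.alphaHi κ s) :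
    ((psiN.symm (b.Ypt h s) : 𝕊 3) : 𝔼 4) = b.spikePiece hcross κ b.depthSign 1 s := by
  rw [b.psiN_symm_Ypt h (b.knotPt_ne_northPole h hB h1 h2)]; rfl

/-- **Off the content set the scaling family is the spiked piece function.** [folklore] -/
theorem scalePiece_eq_of_not_mem (hB : B.InSouth) (lam₀ u : ℝ) {s : ℝ}
    (hs : s ∉ b.contentSet h.spike.κ_pos h.spike.seven_le_gapLo h.spike.seven_le_gapHi) :
    b.scalePiece h lam₀ u s = b.spikePiece hcross κ b.depthSign 1 s := by
  rw [scalePiece]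
  by_cases hθ : b.regionTheta κ s = 0
  · rw [hθ, zero_smul, add_zero]
  · obtain ⟨h1, h2⟩ := b.alpha_gt_of_regionTheta_ne_zero hθ
    rw [b.scalePt_of_windowProd_eq_zero h (b.windowProd_eq_zero_of_not_mem h h1.le h2.le hs), b.psiN_symm_Ypt' h hB h1.le h2.le,
      sub_self, smul_zero, add_zero]

/-- **At `u = 0` the scaling family is the spiked piece function.** [folklore] -/
theorem scalePiece_zero (hB : B.InSouth) (lam₀ s : ℝ) : b.scalePiece h lam₀ 0 s = b.spikePiece hcross κ b.depthSign 1 s := by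
  rw [scalePiece]
  by_cases hθ : b.regionTheta κ s = 0
  · rw [hθ, zero_smul, add_zero]
  · obtain ⟨h1, h2⟩ := b.alpha_gt_of_regionTheta_ne_zero hθ
    rw [b.scalePt_zero, b.psiN_symm_Ypt' h hB h1.le h2.le, sub_self, smul_zero, add_zero]

/-- **On the content set the scaling family is `ψ⁻¹ (Z u s)`.** [folklore] -/
theorem scalePiece_eq_of_mem (lam₀ u : ℝ) {s : ℝ} (hs : s ∈ b.contentSet h.spike.κ_pos h.spike.seven_le_gapLo h.spike.seven_le_gapHi) :
    b.scalePiece h lam₀ u s = ((psiN.symm (b.scalePt h lam₀ u s) : 𝕊 3) : 𝔼 4) := by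
  rw [scalePiece, b.regionTheta_eq_one_of_mem h hs, one_smul, add_sub_cancel]

/-- **In the extended region the scaling family is `ψ⁻¹ (Z u s)`** (on the content set by the
previous lemma, off it because there `Z = Y` and `ψ⁻¹ Y` is the knot point). [folklore] -/
theorem scalePiece_eq_of_region (hB : B.InSouth) (lam₀ u : ℝ) {s : ℝ} (h1 : 1 / 4 ≤ b.alphaLo κ s) (h2 : 1 / 4 ≤ b.alphaHi κ s) :
    b.scalePiece h lam₀ u s = ((psiN.symm (b.scalePt h lam₀ u s) : 𝕊 3) : 𝔼 4) := by
  by_cases hs : s ∈ b.contentSet h.spike.κ_pos h.spike.seven_le_gapLo h.spike.seven_le_gapHi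
  · exact b.scalePiece_eq_of_mem h lam₀ u hs
  · rw [b.scalePiece_eq_of_not_mem h hB lam₀ u hs, b.scalePt_of_windowProd_eq_zero h (b.windowProd_eq_zero_of_not_mem h h1 h2 hs),
      b.psiN_symm_Ypt' h hB h1 h2]

/-- **The scaling family is a unit vector on the content set.** [folklore] -/
theorem norm_scalePiece_of_mem (lam₀ u : ℝ) {s : ℝ} (hs : s ∈ b.contentSet h.spike.κ_pos h.spike.seven_le_gapLo h.spike.seven_le_gapHi) :
    ‖b.scalePiece h lam₀ u s‖ = 1 := by
  rw [b.scalePiece_eq_of_mem h lam₀ u hs]; exact norm_eq_of_mem_sphere _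

/-! ### Smoothness -/

/-- The knot point map is smooth into the sphere. [folklore] -/
theorem contMDiff_knotPt : ContMDiff 𝓘(ℝ, ℝ) (𝓡 3) ∞ (b.knotPt h) :=
  (b.contDiff_spikePiece_stage hcross h.spike.κ_pos h.spike.eight_le_poleRad b.depthSign 1).contMDiff.codRestrict_sphere _

/-- **The chart value is `C^∞` at every parameter whose knot point is not the north pole.**
[folklore] -/
theorem contDiffAt_Ypt {s : ℝ} (hs : b.knotPt h s ≠ northPole) : ContDiffAt ℝ ∞ (b.Ypt h) s := by
  have h1 : ContMDiffAt 𝓘(ℝ, ℝ) (𝓡 3) ∞ (b.knotPt h) s := (b.contMDiff_knotPt h) s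
  have h2 : ContMDiffAt (𝓡 3) 𝓘(ℝ, 𝔼 3) ∞ psiN (b.knotPt h s) := isFullChart_psiN.contMDiffAt (mem_psiN_source hs)
  exact contMDiffAt_iff_contDiffAt.1 (h2.comp s h1)

/-- The chart value is `C^∞` at every parameter of the extended region. [folklore] -/
theorem contDiffAt_Ypt_of_region (hB : B.InSouth) {s : ℝ} (h1 : 1 / 4 ≤ b.alphaLo κ s) (h2 : 1 / 4 ≤ b.alphaHi κ s) :
    ContDiffAt ℝ ∞ (b.Ypt h) s :=
  b.contDiffAt_Ypt h (b.knotPt_ne_northPole h hB h1 h2)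

/-- The scaled chart point is jointly `C^∞` at `(u, s)` for `s` in the extended region. [folklore] -/
theorem contDiffAt_scalePt (hB : B.InSouth) (lam₀ : ℝ) {u s : ℝ} (h1 : 1 / 4 ≤ b.alphaLo κ s) (h2 : 1 / 4 ≤ b.alphaHi κ s) :
    ContDiffAt ℝ ∞ (uncurry (b.scalePt h lam₀)) (u, s) := by
  have hY : ContDiffAt ℝ ∞ (b.Ypt h ∘ Prod.snd) (u, s) :=
    ContDiffAt.comp (g := b.Ypt h) (f := Prod.snd) (u, s) (b.contDiffAt_Ypt_of_region h hB h1 h2) contDiffAt_snd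
  have hΛ : ContDiffAt ℝ ∞ (uncurry (b.scaleFn κ lam₀)) (u, s) := (b.contDiff_scaleFn κ lam₀).contDiffAt
  exact contDiffAt_const.add (hΛ.smul (hY.sub contDiffAt_const))

/-- **The scaling family is jointly `C^∞` in `(u, s)`** (off the extended region the region
cut-off vanishes identically nearby; on it all terms are smooth). [folklore] -/
theorem contDiff_scalePiece (hB : B.InSouth) (lam₀ : ℝ) : ContDiff ℝ ∞ (uncurry (b.scalePiece h lam₀)) := by
  have hF : ContDiff ℝ ∞ (fun p : ℝ × ℝ ↦ b.spikePiece hcross κ b.depthSign 1 p.2) :=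
    (b.contDiff_spikePiece_stage hcross h.spike.κ_pos h.spike.eight_le_poleRad b.depthSign 1).comp contDiff_snd
  have hθ : ContDiff ℝ ∞ (fun p : ℝ × ℝ ↦ b.regionTheta κ p.2) := (b.contDiff_regionTheta κ).comp contDiff_snd
  have hT : ContDiff ℝ ∞ (fun p : ℝ × ℝ ↦ b.regionTheta κ p.2 •
      ((((psiN.symm (b.scalePt h lam₀ p.1 p.2)) : 𝕊 3) : 𝔼 4) - b.spikePiece hcross κ b.depthSign 1 p.2)) := by
    rw [contDiff_iff_contDiffAt]
    rintro ⟨u, s⟩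
    by_cases hreg : 1 / 4 ≤ b.alphaLo κ s ∧ 1 / 4 ≤ b.alphaHi κ s
    · have hZ := b.contDiffAt_scalePt h hB lam₀ (u := u) hreg.1 hreg.2
      have hA : ContDiffAt ℝ ∞ ((fun y : 𝔼 3 ↦ ((psiN.symm y : 𝕊 3) : 𝔼 4)) ∘ uncurry (b.scalePt h lam₀)) (u, s) :=
        ContDiffAt.comp (g := fun y : 𝔼 3 ↦ ((psiN.symm y : 𝕊 3) : 𝔼 4)) (f := uncurry (b.scalePt h lam₀)) (u, s)
          contDiff_coe_psiN_symm.contDiffAt hZ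
      exact hθ.contDiffAt.smul (hA.sub hF.contDiffAt)
    · -- the cut-off vanishes near `(u, s)`
      have hopen : IsOpen {p : ℝ × ℝ | b.alphaLo κ p.2 < 1 / 4 ∨ b.alphaHi κ p.2 < 1 / 4} :=
        (isOpen_lt ((b.contDiff_alphaLo κ).continuous.comp continuous_snd) continuous_const).union
          (isOpen_lt ((b.contDiff_alphaHi κ).continuous.comp continuous_snd) continuous_const)
      have hmem : (u, s) ∈ {p : ℝ × ℝ | b.alphaLo κ p.2 < 1 / 4 ∨ b.alphaHi κ p.2 < 1 / 4} := by
        simp only [mem_setOf_eq]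
        rw [not_and_or, not_le, not_le] at hreg
        exact hreg
      refine (contDiffAt_const (c := (0 : 𝔼 4))).congr_of_eventuallyEq ?_
      filter_upwards [hopen.mem_nhds hmem] with p hp
      have : b.regionTheta κ p.2 = 0 := by
        rcases hp with hp | hp
        · simp [regionTheta, regionCut_eq_zero hp.le]
        · simp [regionTheta, regionCut_eq_zero hp.le]
      simp [this]
  have e : uncurry (b.scalePiece h lam₀) = fun p : ℝ × ℝ ↦ b.spikePiece hcross κ b.depthSign 1 p.2 +
      b.regionTheta κ p.2 • ((((psiN.symm (b.scalePt h lam₀ p.1 p.2)) : 𝕊 3) : 𝔼 4) - b.spikePiece hcross κ b.depthSign 1 p.2) := by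
    funext p; rfl
  rw [e]; exact hF.add hT

/-- Each stage of the scaling family is `C^∞`. [folklore] -/
theorem contDiff_scalePiece_stage (hB : B.InSouth) (lam₀ u : ℝ) : ContDiff ℝ ∞ (b.scalePiece h lam₀ u) := by
  have hc : ContDiff ℝ ∞ (fun t : ℝ ↦ ((u, t) : ℝ × ℝ)) := (contDiff_const (c := u)).prodMk (contDiff_id (E := ℝ))
  have h1 := ContDiff.comp (g := uncurry (b.scalePiece h lam₀)) (f := fun t : ℝ ↦ ((u, t) : ℝ × ℝ))
    (b.contDiff_scalePiece h hB lam₀) hc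
  have e : uncurry (b.scalePiece h lam₀) ∘ (fun t : ℝ ↦ ((u, t) : ℝ × ℝ)) = b.scalePiece h lam₀ u := by
    funext t; rfl
  rwa [e] at h1

/-! ### The seam and the regularity of the spiked piece function -/

/-- The spiked piece function at `u = 1` has the seam property. [folklore] -/
theorem spikePiece_one_seam : ∀ t ∈ Ioo (b.alo - b.seamEps) (b.alo + b.seamEps),
    b.spikePiece hcross κ b.depthSign 1 (t + 1) = b.spikePiece hcross κ b.depthSign 1 t :=
  seam_of_eqOn_compl (b.neckPiece_seam κ) (b.spikeSet_subset κ) fun _ ht ↦ b.spikePiece_eq_neckPiece' h.spike 1 ht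

/-- The spiked piece function at `u = 1` is regular on the fundamental domain. [folklore] -/
theorem deriv_spikePiece_one_ne_zero {s : ℝ} (hs : s ∈ Ico b.alo (b.alo + 1)) :
    deriv (b.spikePiece hcross κ b.depthSign 1) s ≠ 0 :=
  (b.isRegularLoop_spikeLoop h.spike ⟨zero_le_one, le_rfl⟩).deriv_ne_zero_of_mem b.seamEps_bounds.1
    (b.spikePiece_one_seam h) hs

/-- The content set lies in the fundamental domain. [folklore] -/
theorem contentSet_subset_Ico : b.contentSet h.spike.κ_pos h.spike.seven_le_gapLo h.spike.seven_le_gapHi ⊆ Ico b.alo (b.alo + 1) := by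
  intro s hs
  have hjl := (b.juncLo_spec h.spike.κ_pos h.spike.seven_le_gapLo).1
  have hjh := (b.juncHi_spec h.spike.κ_pos h.spike.seven_le_gapHi).1
  obtain ⟨hw1, hw2, hε⟩ := b.tcLo_window
  obtain ⟨hw3, hw4, hε'⟩ := b.tcHi_window
  have hm := b.marks_lt
  obtain ⟨hs0, hs1, hs2, hs3⟩ := b.seamEps_bounds
  exact ⟨by linarith [hs.1, hjl.1], by linarith [hs.2, hjh.2]⟩

/-- The content set lies in `[alo + seamEps, alo + 1 - seamEps]`. [folklore] -/
theorem contentSet_subset_seam : b.contentSet h.spike.κ_pos h.spike.seven_le_gapLo h.spike.seven_le_gapHi ⊆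
    Icc (b.alo + b.seamEps) (b.alo + 1 - b.seamEps) := by
  intro s hs
  have hjl := (b.juncLo_spec h.spike.κ_pos h.spike.seven_le_gapLo).1
  have hjh := (b.juncHi_spec h.spike.κ_pos h.spike.seven_le_gapHi).1
  obtain ⟨hn1, hn2, hn3, hn4⟩ := b.neckSet_bounds
  have hε := b.epsLo_bounds.1
  have hε' := b.epsHi_bounds.1
  exact ⟨by linarith [hs.1, hjl.1], by linarith [hs.2, hjh.2]⟩

/-- The parameters of the extended region lie in the fundamental domain. [folklore] -/
theorem mem_Ico_of_region {s : ℝ} (h1 : 1 / 4 ≤ b.alphaLo κ s) (h2 : 1 / 4 ≤ b.alphaHi κ s) : s ∈ Ico b.alo (b.alo + 1) := by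
  obtain ⟨hs1, hs2⟩ := b.mem_Ioo_of_alpha_gt h h1 h2
  obtain ⟨hw1, hw2, hε⟩ := b.tcLo_window
  obtain ⟨hw3, hw4, hε'⟩ := b.tcHi_window
  have hm := b.marks_lt
  obtain ⟨hs0, -, -, -⟩ := b.seamEps_bounds
  exact ⟨by linarith, by linarith⟩

/-- **The chart value has nonzero derivative on the extended region** (the spiked piece function
is `ψ⁻¹ ∘ Y` there and is regular). [folklore] -/
theorem deriv_Ypt_ne_zero (hB : B.InSouth) {s : ℝ} (h1 : 1 / 4 < b.alphaLo κ s) (h2 : 1 / 4 < b.alphaHi κ s) :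
    deriv (b.Ypt h) s ≠ 0 := by
  intro h0
  -- near `s`, `spikePiece = (coe ∘ ψ⁻¹) ∘ Y`
  have hopen : IsOpen {s' : ℝ | 1 / 4 < b.alphaLo κ s' ∧ 1 / 4 < b.alphaHi κ s'} :=
    (isOpen_lt continuous_const (b.contDiff_alphaLo κ).continuous).inter
      (isOpen_lt continuous_const (b.contDiff_alphaHi κ).continuous)
  have hev : b.spikePiece hcross κ b.depthSign 1 =ᶠ[𝓝 s]
      fun s' ↦ ((psiN.symm (b.Ypt h s') : 𝕊 3) : 𝔼 4) := by
    filter_upwards [hopen.mem_nhds (show s ∈ {s' | _} from ⟨h1, h2⟩)] with s' hs'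
    exact (b.psiN_symm_Ypt' h hB hs'.1.le hs'.2.le).symm
  have hY : HasDerivAt (b.Ypt h) (deriv (b.Ypt h) s) s :=
    ((b.contDiffAt_Ypt_of_region h hB h1.le h2.le).differentiableAt (by simp)).hasDerivAt
  have hc := ((contDiff_coe_psiN_symm.differentiable (by simp)) (b.Ypt h s)).hasFDerivAt.comp_hasDerivAt s hY
  rw [h0, map_zero] at hc
  have hd : deriv (b.spikePiece hcross κ b.depthSign 1) s = 0 := by
    rw [hev.deriv_eq]; exact hc.deriv
  exact b.deriv_spikePiece_one_ne_zero h (b.mem_Ico_of_region h h1.le h2.le) hd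

/-! ### The straight spikes: the spike scalar -/

omit h in
/-- **The spike scalar** `ψ_c(α) = (1 - γ(α) c) (1 - (α - 1/4)/(3/4))`: the position on the
segment from the centre (`0`) to the base (`1`) of the reparametrised straight spike. [folklore] -/
def spikeScalar (c α : ℝ) : ℝ := (1 - spikeWin α * c) * (1 - (α - 1 / 4) / (3 / 4))

omit h in
/-- The spike scalar is `C^∞` in `α`. [folklore] -/
theorem contDiff_spikeScalar (c : ℝ) : ContDiff ℝ ∞ (spikeScalar c) :=
  (contDiff_const.sub (contDiff_spikeWin.mul contDiff_const)).mul
    (contDiff_const.sub ((contDiff_id.sub contDiff_const).div_const _))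

omit h in
/-- **The spike scalar has negative derivative** on `α < 1` for `c ∈ [0, 1)`. [folklore] -/
theorem deriv_spikeScalar_neg {c α : ℝ} (hc : c ∈ Ico (0 : ℝ) 1) (hα : α < 1) : deriv (spikeScalar c) α < 0 := by
  have hγ := (contDiff_spikeWin.differentiable (by simp)) α
  have hd : HasDerivAt (spikeScalar c)
      ((0 - deriv spikeWin α * c) * (1 - (α - 1 / 4) / (3 / 4)) + (1 - spikeWin α * c) * (0 - (1 - 0) / (3 / 4))) α := by
    have h1 : HasDerivAt (fun α ↦ 1 - spikeWin α * c) (0 - deriv spikeWin α * c) α :=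
      (hasDerivAt_const α (1:ℝ)).sub (hγ.hasDerivAt.mul_const c)
    have h2 : HasDerivAt (fun α : ℝ ↦ 1 - (α - 1 / 4) / (3 / 4)) (0 - (1 - 0) / (3 / 4)) α :=
      (hasDerivAt_const α (1:ℝ)).sub (((hasDerivAt_id α).sub (hasDerivAt_const α _)).div_const _)
    exact h1.mul h2
  rw [hd.deriv]
  have hγ' : 0 ≤ deriv spikeWin α := deriv_smoothStep_nonneg (by norm_num) α
  have hγ01 := spikeWin_mem_Icc α
  have hℓ : 0 ≤ 1 - (α - 1 / 4) / (3 / 4) := by rw [sub_nonneg, div_le_one (by norm_num)]; linarith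
  have h1c : 0 < 1 - spikeWin α * c := by nlinarith [hγ01.1, hγ01.2, hc.1, hc.2]
  nlinarith [mul_nonneg (mul_nonneg hγ' hc.1) hℓ]

omit h in
/-- The spike scalar is strictly decreasing on `(-∞, 1]`. [folklore] -/
theorem strictAntiOn_spikeScalar {c : ℝ} (hc : c ∈ Ico (0 : ℝ) 1) : StrictAntiOn (spikeScalar c) (Iio 1) :=
  strictAntiOn_of_deriv_neg (convex_Iio _) (contDiff_spikeScalar c).continuous.continuousOn
    (fun α hα ↦ deriv_spikeScalar_neg hc (by simpa using interior_subset hα))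

omit h in
/-- The spike scalar is positive on `α < 1` for `c ∈ [0, 1)`. [folklore] -/
theorem spikeScalar_pos {c α : ℝ} (hc : c ∈ Ico (0 : ℝ) 1) (hα : α < 1) : 0 < spikeScalar c α := by
  have hγ01 := spikeWin_mem_Icc α
  have h1c : 0 < 1 - spikeWin α * c := by nlinarith [hγ01.1, hγ01.2, hc.1, hc.2]
  have hℓ : 0 < 1 - (α - 1 / 4) / (3 / 4) := by rw [sub_pos, div_lt_one (by norm_num)]; linarith
  exact mul_pos h1c hℓ

omit h in
/-- The spike scalar is at most `5/6` on `[3/8, 1]`. [folklore] -/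
theorem spikeScalar_le {c α : ℝ} (hc : c ∈ Ico (0 : ℝ) 1) (hα : 3 / 8 ≤ α) (hα1 : α ≤ 1) : spikeScalar c α ≤ 5 / 6 := by
  have hγ01 := spikeWin_mem_Icc α
  have h1c : 1 - spikeWin α * c ≤ 1 := by nlinarith [hγ01.1, hc.1]
  have h1c' : 0 ≤ 1 - spikeWin α * c := by nlinarith [hγ01.1, hγ01.2, hc.1, hc.2]
  have hℓ : 1 - (α - 1 / 4) / (3 / 4) ≤ 5 / 6 := by rw [sub_le_comm, le_div_iff₀ (by norm_num)]; linarith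
  have hℓ' : 0 ≤ 1 - (α - 1 / 4) / (3 / 4) := by rw [sub_nonneg, div_le_one (by norm_num)]; linarith
  calc spikeScalar c α ≤ 1 * (5 / 6) := mul_le_mul h1c hℓ hℓ' zero_le_one
    _ = 5 / 6 := one_mul _

/-- The lower base point differs from the centre. [folklore] -/
theorem baseLo_sub_oS_ne_zero : b.blowDown hcross κ (pt3 (1 / 4) (-1) 0) - b.oS hcross κ b.depthSign ≠ 0 := by
  rw [oS, blowDown_sub]
  refine smul_ne_zero h.spike.κ_pos.ne' fun h0 ↦ ?_
  have := (b.frame hcross).injective (h0.trans (map_zero _).symm)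
  have := congrArg (fun Y : 𝔼 3 ↦ Y 1) this
  norm_num at this

/-- The upper base point differs from the centre. [folklore] -/
theorem baseHi_sub_oS_ne_zero : b.blowDown hcross κ (pt3 (1 / 4) 1 0) - b.oS hcross κ b.depthSign ≠ 0 := by
  rw [oS, blowDown_sub]
  refine smul_ne_zero h.spike.κ_pos.ne' fun h0 ↦ ?_
  have := (b.frame hcross).injective (h0.trans (map_zero _).symm)
  have := congrArg (fun Y : 𝔼 3 ↦ Y 1) this
  norm_num at this

omit h in omit b in
/-- The parameter `c = u (1 - λ₀)` lies in `[0, 1)` for `u ∈ [0, 1]`, `λ₀ ∈ (0, 1]`. [folklore] -/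
theorem cParam_mem {lam₀ u : ℝ} (hl : lam₀ ∈ Ioc (0 : ℝ) 1) (hu : u ∈ Icc (0 : ℝ) 1) : u * (1 - lam₀) ∈ Ico (0 : ℝ) 1 :=
  ⟨mul_nonneg hu.1 (by linarith [hl.2]), by nlinarith [hl.1, hl.2, hu.1, hu.2]⟩

/-- **On the lower straight spike the scaled chart point is `oS + ψ_c(αLo s) (baseLo - oS)`**, for
`s` in the closed lower core with `αLo s ∈ [1/4, 3/4]`. [folklore] -/
theorem scalePt_lowerSpike {lam₀ u : ℝ} {s : ℝ} (hs : s ∈ Icc (b.tcLo - b.epsLo / 8) (b.tcLo + b.epsLo / 8))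
    (hα : b.alphaLo κ s ∈ Icc (1 / 4 : ℝ) (3 / 4)) :
    b.scalePt h lam₀ u s = b.oS hcross κ b.depthSign + spikeScalar (u * (1 - lam₀)) (b.alphaLo κ s) • (b.blowDown hcross κ (pt3 (1 / 4) (-1) 0) - b.oS hcross κ b.depthSign) := by
  have hκ := h.spike.κ_pos
  have h8 := h.spike.eight_lt_r
  obtain ⟨hw1, hw2, hε⟩ := b.tcLo_window
  have hm := b.marks_lt
  have hflat : κ * (|b.alphaLo κ s| + 1) < r := by
    rw [abs_of_nonneg (by linarith [hα.1])]; nlinarith [hα.2]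
  have hY : b.Ypt h s = b.pieceLo hcross κ b.depthSign 1 (b.alphaLo κ s) :=
    (b.Ypt_eq_of_eq h (b.spikePiece_one_coreLo h.spike hs (norm_railLoParam_lt hκ hflat))).2
  have hHi : spikeWin (b.alphaHi κ s) = 1 := spikeWin_eq_one (by linarith [b.six_le_alphaHi_of_coreLo h (show s ≤ b.thi by linarith [hs.2])])
  rw [scalePt, hY, b.pieceLo_one_eq_lineLo hcross hα, b.blowDown_lineLo_eq hcross, scaleFn, windowProd, hHi, mul_one,
    add_sub_cancel_left, smul_smul, spikeScalar]

/-- On the upper straight spike the scaled chart point is `oS + ψ_c(αHi s) (baseHi - oS)`. [folklore] -/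
theorem scalePt_upperSpike {lam₀ u : ℝ} {s : ℝ} (hs : s ∈ Icc (b.tcHi - b.epsHi / 8) (b.tcHi + b.epsHi / 8))
    (hα : b.alphaHi κ s ∈ Icc (1 / 4 : ℝ) (3 / 4)) :
    b.scalePt h lam₀ u s = b.oS hcross κ b.depthSign + spikeScalar (u * (1 - lam₀)) (b.alphaHi κ s) • (b.blowDown hcross κ (pt3 (1 / 4) 1 0) - b.oS hcross κ b.depthSign) := by
  have hκ := h.spike.κ_pos
  have h8 := h.spike.eight_lt_r
  obtain ⟨hw1, hw2, hε⟩ := b.tcHi_window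
  have hm := b.marks_lt
  have hflat : κ * (|b.alphaHi κ s| + 1) < r := by
    rw [abs_of_nonneg (by linarith [hα.1])]; nlinarith [hα.2]
  have hY : b.Ypt h s = b.pieceHi hcross κ b.depthSign 1 (b.alphaHi κ s) :=
    (b.Ypt_eq_of_eq h (b.spikePiece_one_coreHi h.spike hs (norm_railHiParam_lt hκ hflat))).2
  have hLo : spikeWin (b.alphaLo κ s) = 1 := spikeWin_eq_one (by linarith [b.six_le_alphaLo_of_coreHi h (show b.tlo ≤ s by linarith [hs.1])])
  rw [scalePt, hY, b.pieceHi_one_eq_lineHi hcross hα, b.blowDown_lineHi_eq hcross, scaleFn, windowProd, hLo, one_mul,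
    add_sub_cancel_left, smul_smul, spikeScalar]

/-- **Where both blown-up parameters exceed `11/16` the scaled chart point is the homothety image**
`oS + λ (Y - oS)`, `λ = 1 - u (1 - λ₀)`. [folklore] -/
theorem scalePt_general {lam₀ u : ℝ} {s : ℝ} (h1 : 11 / 16 ≤ b.alphaLo κ s) (h2 : 11 / 16 ≤ b.alphaHi κ s) :
    b.scalePt h lam₀ u s = b.oS hcross κ b.depthSign + (1 - u * (1 - lam₀)) • (b.Ypt h s - b.oS hcross κ b.depthSign) := by
  rw [scalePt, scaleFn, b.windowProd_eq_one h1 h2, one_mul]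

/-! ### Regularity on the content set -/

/-- **On the lower straight spike the scaled chart point has nonzero derivative** (`u ∈ [0, 1]`,
`λ₀ ∈ (0, 1]`, `αLo s ∈ (1/4, 3/4)`). [folklore] -/
theorem hasDerivAt_scalePt_lowerSpike {lam₀ u : ℝ} (hl : lam₀ ∈ Ioc (0 : ℝ) 1) (hu : u ∈ Icc (0 : ℝ) 1) {s : ℝ}
    (hs : s ∈ Ioo (b.tcLo - b.epsLo / 8) (b.tcLo + b.epsLo / 8)) (hα : b.alphaLo κ s ∈ Ioo (1 / 4 : ℝ) (3 / 4)) :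
    ∃ W : 𝔼 3, HasDerivAt (b.scalePt h lam₀ u) W s ∧ W ≠ 0 := by
  set c := u * (1 - lam₀)
  have hc : c ∈ Ico (0 : ℝ) 1 := cParam_mem hl hu
  -- the closed form holds near `s`
  have hopen : IsOpen (Ioo (b.tcLo - b.epsLo / 8) (b.tcLo + b.epsLo / 8) ∩ (b.alphaLo κ) ⁻¹' Ioo (1 / 4 : ℝ) (3 / 4)) :=
    isOpen_Ioo.inter (isOpen_Ioo.preimage (b.contDiff_alphaLo κ).continuous)
  have hev : b.scalePt h lam₀ u =ᶠ[𝓝 s]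
      fun s' ↦ b.oS hcross κ b.depthSign + spikeScalar c (b.alphaLo κ s') • (b.blowDown hcross κ (pt3 (1 / 4) (-1) 0) - b.oS hcross κ b.depthSign) := by
    filter_upwards [hopen.mem_nhds ⟨hs, hα⟩] with s' hs'
    exact b.scalePt_lowerSpike h (Ioo_subset_Icc_self hs'.1) (Ioo_subset_Icc_self hs'.2)
  have hψ := ((contDiff_spikeScalar c).differentiable (by simp)) (b.alphaLo κ s)
  have hcomp : HasDerivAt (fun s' ↦ spikeScalar c (b.alphaLo κ s')) (deriv (spikeScalar c) (b.alphaLo κ s) * (deriv b.chiLo s / κ)) s :=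
    hψ.hasDerivAt.comp s (b.hasDerivAt_alphaLo κ s)
  have hd : HasDerivAt (fun s' ↦ b.oS hcross κ b.depthSign + spikeScalar c (b.alphaLo κ s') • (b.blowDown hcross κ (pt3 (1 / 4) (-1) 0) - b.oS hcross κ b.depthSign))
      ((deriv (spikeScalar c) (b.alphaLo κ s) * (deriv b.chiLo s / κ)) • (b.blowDown hcross κ (pt3 (1 / 4) (-1) 0) - b.oS hcross κ b.depthSign)) s :=
    (hcomp.smul_const _).const_add _
  refine ⟨_, hd.congr_of_eventuallyEq hev, smul_ne_zero (mul_ne_zero ?_ ?_) (b.baseLo_sub_oS_ne_zero h)⟩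
  · exact (deriv_spikeScalar_neg hc (by linarith [hα.2])).ne
  · exact (div_pos (b.deriv_chiLo_pos (Ioo_subset_Icc_self hs)) h.spike.κ_pos).ne'

/-- On the upper straight spike the scaled chart point has nonzero derivative. [folklore] -/
theorem hasDerivAt_scalePt_upperSpike {lam₀ u : ℝ} (hl : lam₀ ∈ Ioc (0 : ℝ) 1) (hu : u ∈ Icc (0 : ℝ) 1) {s : ℝ}
    (hs : s ∈ Ioo (b.tcHi - b.epsHi / 8) (b.tcHi + b.epsHi / 8)) (hα : b.alphaHi κ s ∈ Ioo (1 / 4 : ℝ) (3 / 4)) :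
    ∃ W : 𝔼 3, HasDerivAt (b.scalePt h lam₀ u) W s ∧ W ≠ 0 := by
  set c := u * (1 - lam₀)
  have hc : c ∈ Ico (0 : ℝ) 1 := cParam_mem hl hu
  have hopen : IsOpen (Ioo (b.tcHi - b.epsHi / 8) (b.tcHi + b.epsHi / 8) ∩ (b.alphaHi κ) ⁻¹' Ioo (1 / 4 : ℝ) (3 / 4)) :=
    isOpen_Ioo.inter (isOpen_Ioo.preimage (b.contDiff_alphaHi κ).continuous)
  have hev : b.scalePt h lam₀ u =ᶠ[𝓝 s]
      fun s' ↦ b.oS hcross κ b.depthSign + spikeScalar c (b.alphaHi κ s') • (b.blowDown hcross κ (pt3 (1 / 4) 1 0) - b.oS hcross κ b.depthSign) := by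
    filter_upwards [hopen.mem_nhds ⟨hs, hα⟩] with s' hs'
    exact b.scalePt_upperSpike h (Ioo_subset_Icc_self hs'.1) (Ioo_subset_Icc_self hs'.2)
  have hψ := ((contDiff_spikeScalar c).differentiable (by simp)) (b.alphaHi κ s)
  have hcomp : HasDerivAt (fun s' ↦ spikeScalar c (b.alphaHi κ s')) (deriv (spikeScalar c) (b.alphaHi κ s) * (deriv b.chiHi s / κ)) s :=
    hψ.hasDerivAt.comp s (b.hasDerivAt_alphaHi κ s)
  have hd : HasDerivAt (fun s' ↦ b.oS hcross κ b.depthSign + spikeScalar c (b.alphaHi κ s') • (b.blowDown hcross κ (pt3 (1 / 4) 1 0) - b.oS hcross κ b.depthSign))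
      ((deriv (spikeScalar c) (b.alphaHi κ s) * (deriv b.chiHi s / κ)) • (b.blowDown hcross κ (pt3 (1 / 4) 1 0) - b.oS hcross κ b.depthSign)) s :=
    (hcomp.smul_const _).const_add _
  refine ⟨_, hd.congr_of_eventuallyEq hev, smul_ne_zero (mul_ne_zero ?_ ?_) (b.baseHi_sub_oS_ne_zero h)⟩
  · exact (deriv_spikeScalar_neg hc (by linarith [hα.2])).ne
  · exact (div_neg_of_neg_of_pos (b.deriv_chiHi_neg (Ioo_subset_Icc_self hs)) h.spike.κ_pos).ne

/-- **On the general content the scaled chart point has nonzero derivative** (`αLo, αHi > 11/16`).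
[folklore] -/
theorem hasDerivAt_scalePt_general (hB : B.InSouth) {lam₀ u : ℝ} (hl : lam₀ ∈ Ioc (0 : ℝ) 1) (hu : u ∈ Icc (0 : ℝ) 1) {s : ℝ}
    (h1 : 11 / 16 < b.alphaLo κ s) (h2 : 11 / 16 < b.alphaHi κ s) :
    ∃ W : 𝔼 3, HasDerivAt (b.scalePt h lam₀ u) W s ∧ W ≠ 0 := by
  have hc : u * (1 - lam₀) ∈ Ico (0 : ℝ) 1 := cParam_mem hl hu
  have hopen : IsOpen {s' : ℝ | 11 / 16 < b.alphaLo κ s' ∧ 11 / 16 < b.alphaHi κ s'} :=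
    (isOpen_lt continuous_const (b.contDiff_alphaLo κ).continuous).inter
      (isOpen_lt continuous_const (b.contDiff_alphaHi κ).continuous)
  have hev : b.scalePt h lam₀ u =ᶠ[𝓝 s]
      fun s' ↦ b.oS hcross κ b.depthSign + (1 - u * (1 - lam₀)) • (b.Ypt h s' - b.oS hcross κ b.depthSign) := by
    filter_upwards [hopen.mem_nhds (show s ∈ {s' | _} from ⟨h1, h2⟩)] with s' hs'
    exact b.scalePt_general h hs'.1.le hs'.2.le
  have hY : HasDerivAt (b.Ypt h) (deriv (b.Ypt h) s) s :=
    ((b.contDiffAt_Ypt_of_region h hB (by linarith) (by linarith)).differentiableAt (by simp)).hasDerivAt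
  have hd := ((hY.sub_const (b.oS hcross κ b.depthSign)).const_smul (1 - u * (1 - lam₀))).const_add (b.oS hcross κ b.depthSign)
  refine ⟨_, hd.congr_of_eventuallyEq hev, smul_ne_zero (by linarith [hc.2]) ?_⟩
  exact b.deriv_Ypt_ne_zero h hB (by linarith) (by linarith)

/-- **The scaled chart point has nonzero derivative at every content parameter.** [folklore] -/
theorem hasDerivAt_scalePt_of_mem (hB : B.InSouth) {lam₀ u : ℝ} (hl : lam₀ ∈ Ioc (0 : ℝ) 1) (hu : u ∈ Icc (0 : ℝ) 1) {s : ℝ}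
    (hs : s ∈ b.contentSet h.spike.κ_pos h.spike.seven_le_gapLo h.spike.seven_le_gapHi) :
    ∃ W : 𝔼 3, HasDerivAt (b.scalePt h lam₀ u) W s ∧ W ≠ 0 := by
  have hκ := h.spike.κ_pos
  obtain ⟨hα1, hα2⟩ := b.alpha_ge_of_mem_contentSet h hs
  by_cases hgen : 11 / 16 < b.alphaLo κ s ∧ 11 / 16 < b.alphaHi κ s
  · exact b.hasDerivAt_scalePt_general h hB hl hu hgen.1 hgen.2
  rw [not_and_or, not_lt, not_lt] at hgen
  rcases hgen with hle | hle
  · -- lower spike: `αLo ∈ [3/8, 11/16]`, so `s` is in the open lower core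
    have hcore := b.mem_coreLo_of_alphaLo hκ (M := 7) (by linarith [h.spike.seven_le_gapLo]) (abs_lt.2 ⟨by linarith, by linarith⟩)
    exact b.hasDerivAt_scalePt_lowerSpike h hl hu hcore ⟨by linarith, by linarith⟩
  · have hcore := b.mem_coreHi_of_alphaHi hκ (M := 7) (by linarith [h.spike.seven_le_gapHi]) (abs_lt.2 ⟨by linarith, by linarith⟩)
    exact b.hasDerivAt_scalePt_upperSpike h hl hu hcore ⟨by linarith, by linarith⟩

/-- **The scaling family is regular on the content set.** [folklore] -/
theorem deriv_scalePiece_ne_zero (hB : B.InSouth) {lam₀ u : ℝ} (hl : lam₀ ∈ Ioc (0 : ℝ) 1) (hu : u ∈ Icc (0 : ℝ) 1) {s : ℝ}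
    (hs : s ∈ b.contentSet h.spike.κ_pos h.spike.seven_le_gapLo h.spike.seven_le_gapHi) :
    deriv (b.scalePiece h lam₀ u) s ≠ 0 := by
  obtain ⟨hα1, hα2⟩ := b.alpha_ge_of_mem_contentSet h hs
  have hopen : IsOpen {s' : ℝ | 1 / 4 < b.alphaLo κ s' ∧ 1 / 4 < b.alphaHi κ s'} :=
    (isOpen_lt continuous_const (b.contDiff_alphaLo κ).continuous).inter
      (isOpen_lt continuous_const (b.contDiff_alphaHi κ).continuous)
  have hev : b.scalePiece h lam₀ u =ᶠ[𝓝 s] fun s' ↦ ((psiN.symm (b.scalePt h lam₀ u s') : 𝕊 3) : 𝔼 4) := by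
    filter_upwards [hopen.mem_nhds (show s ∈ {s' | _} from ⟨by linarith, by linarith⟩)] with s' hs'
    exact b.scalePiece_eq_of_region h hB lam₀ u hs'.1.le hs'.2.le
  rw [hev.deriv_eq]
  obtain ⟨W, hW, hWne⟩ := b.hasDerivAt_scalePt_of_mem h hB hl hu hs
  exact deriv_coe_psiN_symm_comp_ne_zero hW hWne

/-! ### Injectivity on the content set -/

/-- **Kinds of content parameters**: lower straight spike (`αLo ∈ [3/8, 3/4]`, open lower core),
upper straight spike, or general (`αLo, αHi > 3/4`). [folklore] -/
theorem contentKind_cases {s : ℝ} (hs : s ∈ b.contentSet h.spike.κ_pos h.spike.seven_le_gapLo h.spike.seven_le_gapHi) :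
    (s ∈ Ioo (b.tcLo - b.epsLo / 8) (b.tcLo + b.epsLo / 8) ∧ b.alphaLo κ s ∈ Icc (3 / 8 : ℝ) (3 / 4)) ∨
      (s ∈ Ioo (b.tcHi - b.epsHi / 8) (b.tcHi + b.epsHi / 8) ∧ b.alphaHi κ s ∈ Icc (3 / 8 : ℝ) (3 / 4)) ∨
      (3 / 4 < b.alphaLo κ s ∧ 3 / 4 < b.alphaHi κ s) := by
  have hκ := h.spike.κ_pos
  obtain ⟨hα1, hα2⟩ := b.alpha_ge_of_mem_contentSet h hs
  by_cases h1 : b.alphaLo κ s ≤ 3 / 4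
  · exact Or.inl ⟨b.mem_coreLo_of_alphaLo hκ (M := 7) (by linarith [h.spike.seven_le_gapLo]) (abs_lt.2 ⟨by linarith, by linarith⟩), hα1, h1⟩
  by_cases h2 : b.alphaHi κ s ≤ 3 / 4
  · exact Or.inr (Or.inl ⟨b.mem_coreHi_of_alphaHi hκ (M := 7) (by linarith [h.spike.seven_le_gapHi]) (abs_lt.2 ⟨by linarith, by linarith⟩), hα2, h2⟩)
  exact Or.inr (Or.inr ⟨not_le.1 h1, not_le.1 h2⟩)

/-- Blow-up coordinates of a point `oS + t (baseLo - oS)` of the lower ray: `(1 - 3t/4, -t, σ (1 - t))`.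
[folklore] -/
theorem blowUp_rayLo (t : ℝ) :
    b.blowUp hcross κ (b.oS hcross κ b.depthSign + t • (b.blowDown hcross κ (pt3 (1 / 4) (-1) 0) - b.oS hcross κ b.depthSign)) =
      pt3 (1 - 3 * t / 4) (-t) (b.depthSign * (1 - t)) := by
  rw [b.blowUp_chord hcross h.spike.κ_pos.ne', b.blowUp_blowDown hcross h.spike.κ_pos.ne']
  ext i; fin_cases i <;> simp <;> ring

/-- Blow-up coordinates of a point of the upper ray: `(1 - 3t/4, t, σ (1 - t))`. [folklore] -/
theorem blowUp_rayHi (t : ℝ) :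
    b.blowUp hcross κ (b.oS hcross κ b.depthSign + t • (b.blowDown hcross κ (pt3 (1 / 4) 1 0) - b.oS hcross κ b.depthSign)) =
      pt3 (1 - 3 * t / 4) t (b.depthSign * (1 - t)) := by
  rw [b.blowUp_chord hcross h.spike.κ_pos.ne', b.blowUp_blowDown hcross h.spike.κ_pos.ne']
  ext i; fin_cases i <;> simp <;> ring

/-- **Beyond the model range the content has first blow-up coordinate `> 1`** (lower). [folklore] -/
theorem one_lt_blowUp_pieceLo_one_zero {α : ℝ} (hα : 3 < α) (hsc : κ * (|α| + 1) < r) :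
    1 < b.blowUp hcross κ (b.pieceLo hcross κ b.depthSign 1 α) 0 := by
  have hκ := h.spike.κ_pos
  have hf := h.spike.flat
  have hε := h.eps_le
  have hεn := hf.eps_nonneg
  rw [b.blowUp_pieceLo_zero hcross hκ.ne', one_mul]
  have hR := (b.blowUp_railLoPsi_coord hf hκ hsc).1
  have hR' := (abs_le.1 hR).1
  rw [abs_of_nonneg (by linarith)] at hR'
  have h1 : 1 < b.blowUp hcross κ (b.railLoPsi κ α) 0 := by nlinarith
  calc (1 : ℝ) < min (b.blowUp hcross κ (b.railLoPsi κ α) 0) α := lt_min h1 (by linarith)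
    _ ≤ _ := min_le_convexComb (spikeBump_mem_Icc α)

/-- Beyond the model range the content has first blow-up coordinate `> 1` (upper). [folklore] -/
theorem one_lt_blowUp_pieceHi_one_zero {α : ℝ} (hα : 3 < α) (hsc : κ * (|α| + 1) < r) :
    1 < b.blowUp hcross κ (b.pieceHi hcross κ b.depthSign 1 α) 0 := by
  have hκ := h.spike.κ_pos
  have hf := h.spike.flat
  have hε := h.eps_le
  have hεn := hf.eps_nonneg
  rw [b.blowUp_pieceHi_zero hcross hκ.ne', one_mul]
  have hR := (b.blowUp_railHiPsi_coord hf hκ hsc).1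
  have hR' := (abs_le.1 hR).1
  rw [abs_of_nonneg (by linarith)] at hR'
  have h1 : 1 < b.blowUp hcross κ (b.railHiPsi κ α) 0 := by nlinarith
  calc (1 : ℝ) < min (b.blowUp hcross κ (b.railHiPsi κ α) 0) α := lt_min h1 (by linarith)
    _ ≤ _ := min_le_convexComb (spikeBump_mem_Icc α)

omit h in omit b in
/-- Right of `3/4` the return step is positive, so the spike profile is below the affine fraction.
[folklore] -/
theorem spikeProfile_lt_frac {α : ℝ} (hα : 3 / 4 < α) : spikeProfile α < (α - 1 / 4) / (3 / 4) := by
  have hpos : 0 < returnStep α := by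
    rcases lt_or_ge α (7 / 8) with h1 | h1
    · exact (smoothStep_mem_Ioo (by norm_num) ⟨hα, h1⟩).1
    · rw [returnStep_eq_one h1]; norm_num
  have hA : 0 < (α - 1 / 4) / (3 / 4) := div_pos (by linarith) (by norm_num)
  rw [spikeProfile]; nlinarith

omit h in omit b in
/-- The depth of any chart point is at most `4` times its distance from a point of norm `2`.
[folklore] -/
theorem depth_le_four_mul_norm_sub {y p : 𝔼 3} (hp : ‖p‖ = 2) : depth y ≤ 4 * ‖y - p‖ := by
  have h1 : ‖p‖ - ‖y - p‖ ≤ ‖y‖ := by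
    have := norm_sub_norm_le p y; rw [norm_sub_rev] at this; linarith
  rw [hp] at h1
  rw [depth]
  by_cases h2 : ‖y - p‖ ≤ 2
  · have : (2 - ‖y - p‖) ^ 2 ≤ ‖y‖ ^ 2 := pow_le_pow_left₀ (by linarith) h1 2
    nlinarith [norm_nonneg (y - p)]
  · push Not at h2; nlinarith [norm_nonneg y]

/-! ### The shrink scale hypotheses -/

/-- **The shrink scale hypotheses**: a cone scale, a target ratio `λ₀ ∈ (0, 1]`, and a far depth
exceeding the depth of the rays through the straight spikes up to the parameter `5/(6λ₀)`.
[folklore] -/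
structure ShrinkScale (hcross : b.band ⁻¹' sphereEquator 2 ∩ squareNhd b.δ = {x ∈ squareNhd b.δ | x 0 = 2⁻¹})
    (ε r A' κ lam₀ : ℝ) : Prop where
  cone : b.ConeScale hcross ε r A' κ
  lam_mem : lam₀ ∈ Ioc (0 : ℝ) 1
  ray_depth : ∃ d : ℝ, (∀ x ∈ b.farSouth (min (r / 2) (min b.gapLo b.gapHi)), d ≤ depth (psiN x)) ∧
    4 * κ * ‖((b.frame hcross : (𝔼 3) ≃L[ℝ] 𝔼 3) : (𝔼 3) →L[ℝ] 𝔼 3)‖ * (2 + 5 / (2 * lam₀)) < d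

omit h

variable {lam₀ : ℝ} (H : b.ShrinkScale hcross ε r A' κ lam₀)
include H

/-- A chart point of blow-up norm `≤ 2 + 3t`, `0 ≤ t ≤ 5/(6λ₀)`, is shallower than the far content.
[folklore] -/
theorem depth_lt_of_norm_blowUp_le {t : ℝ} (ht : t ∈ Icc (0 : ℝ) (5 / (6 * lam₀))) {y : 𝔼 3}
    (hbu : ‖b.blowUp hcross κ y‖ ≤ 2 + 3 * t) {x : 𝕊 3} (hx : x ∈ b.farSouth (min (r / 2) (min b.gapLo b.gapHi))) :
    depth y < depth (psiN x) := by
  obtain ⟨d, hd, hκd⟩ := H.ray_depth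
  have h := H.cone
  have hκ := h.spike.κ_pos
  have hl := H.lam_mem
  set N := ‖((b.frame hcross : (𝔼 3) ≃L[ℝ] 𝔼 3) : (𝔼 3) →L[ℝ] 𝔼 3)‖
  have hdist : ‖y - b.pZero‖ ≤ κ * N * (2 + 5 / (2 * lam₀)) := by
    refine (b.norm_sub_pZero_le hκ (hcross := hcross) y).trans ?_
    refine mul_le_mul_of_nonneg_left (hbu.trans ?_) (mul_nonneg hκ.le (norm_nonneg _))
    have : 3 * t ≤ 5 / (2 * lam₀) := by
      have := ht.2; rw [le_div_iff₀ (by linarith [hl.1])] at this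
      rw [le_div_iff₀ (by linarith [hl.1])]; linarith
    linarith
  have hdy : depth y ≤ 4 * ‖y - b.pZero‖ := depth_le_four_mul_norm_sub (b.norm_pZero hcross)
  have := hd x hx
  nlinarith [norm_nonneg (y - b.pZero)]

/-- **A point of the lower ray `oS + t (baseLo - oS)`, `0 ≤ t ≤ 5/(6λ₀)`, is shallower than the
far content.** [folklore] -/
theorem depth_rayLo_lt {t : ℝ} (ht : t ∈ Icc (0 : ℝ) (5 / (6 * lam₀))) {x : 𝕊 3}
    (hx : x ∈ b.farSouth (min (r / 2) (min b.gapLo b.gapHi))) :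
    depth (b.oS hcross κ b.depthSign + t • (b.blowDown hcross κ (pt3 (1 / 4) (-1) 0) - b.oS hcross κ b.depthSign)) < depth (psiN x) := by
  refine b.depth_lt_of_norm_blowUp_le H ht ?_ hx
  rw [b.blowUp_rayLo H.cone t]
  refine (norm_pt3_le _ _ _).trans ?_
  have h1 : |1 - 3 * t / 4| ≤ 1 + 3 * t / 4 := abs_le.2 ⟨by linarith [ht.1], by linarith [ht.1]⟩
  have h2 : |(-t)| = t := by rw [abs_neg, abs_of_nonneg ht.1]
  have h3 : |b.depthSign * (1 - t)| ≤ 1 + t := by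
    rw [abs_mul, b.abs_depthSign, one_mul]; exact abs_le.2 ⟨by linarith [ht.1], by linarith [ht.1]⟩
  linarith [ht.1]

/-- A point of the upper ray is shallower than the far content. [folklore] -/
theorem depth_rayHi_lt {t : ℝ} (ht : t ∈ Icc (0 : ℝ) (5 / (6 * lam₀))) {x : 𝕊 3}
    (hx : x ∈ b.farSouth (min (r / 2) (min b.gapLo b.gapHi))) :
    depth (b.oS hcross κ b.depthSign + t • (b.blowDown hcross κ (pt3 (1 / 4) 1 0) - b.oS hcross κ b.depthSign)) < depth (psiN x) := by
  refine b.depth_lt_of_norm_blowUp_le H ht ?_ hx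
  rw [b.blowUp_rayHi H.cone t]
  refine (norm_pt3_le _ _ _).trans ?_
  have h1 : |1 - 3 * t / 4| ≤ 1 + 3 * t / 4 := abs_le.2 ⟨by linarith [ht.1], by linarith [ht.1]⟩
  have h2 : |t| = t := abs_of_nonneg ht.1
  have h3 : |b.depthSign * (1 - t)| ≤ 1 + t := by
    rw [abs_mul, b.abs_depthSign, one_mul]; exact abs_le.2 ⟨by linarith [ht.1], by linarith [ht.1]⟩
  linarith [ht.1]

variable (hB : B.InSouth) (hAB : Disjoint (range A) (range B))

/-- **A point of a lower ray is not the chart value of a general content parameter.** Precisely: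
for `s'` in the content set with `αLo s' > 3/4` and `αHi s' > 3/4`, `Y s' ≠ oS + t (baseLo - oS)` for
`0 < t ≤ 5/(6λ₀)`. [folklore] -/
theorem Ypt_ne_rayLo {s' : ℝ} (hs' : s' ∈ b.contentSet H.cone.spike.κ_pos H.cone.spike.seven_le_gapLo H.cone.spike.seven_le_gapHi)
    (hg1 : 3 / 4 < b.alphaLo κ s') (hg2 : 3 / 4 < b.alphaHi κ s') {t : ℝ} (ht : t ∈ Ioc (0 : ℝ) (5 / (6 * lam₀))) :
    b.Ypt H.cone s' ≠ b.oS hcross κ b.depthSign + t • (b.blowDown hcross κ (pt3 (1 / 4) (-1) 0) - b.oS hcross κ b.depthSign) := by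
  have h := H.cone
  have hκ := h.spike.κ_pos
  have hf := h.spike.flat
  intro he
  have hbu := congrArg (b.blowUp hcross κ) he
  rw [b.blowUp_rayLo h t] at hbu
  rcases b.content_cases h hs' with ⟨hsc, hα, hq, -, hY⟩ | ⟨hsc, hα, hq, -, hY⟩ | hfar
  · rw [hY] at hbu
    by_cases h3 : b.alphaLo κ s' ≤ 3
    · rw [b.blowUp_pieceLo_one_of_mem hcross hκ.ne' ⟨by linarith, h3⟩, modelLo] at hbu
      have e0 : b.alphaLo κ s' = 1 - 3 * t / 4 := by simpa using congrArg (fun Y : 𝔼 3 ↦ Y 0) hbu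
      have e1 : -1 + spikeProfile (b.alphaLo κ s') = -t := by simpa using congrArg (fun Y : 𝔼 3 ↦ Y 1) hbu
      have hlt := spikeProfile_lt_frac hg1
      -- `α = 1 - 3t/4`, `-1 + s = -t` force `s = (α - 1/4)/(3/4)`
      have : spikeProfile (b.alphaLo κ s') = (b.alphaLo κ s' - 1 / 4) / (3 / 4) := by
        rw [eq_div_iff (by norm_num)]; linarith
      linarith
    · push Not at h3
      have h1 := b.one_lt_blowUp_pieceLo_one_zero h h3 hq
      have e0 : b.blowUp hcross κ (b.pieceLo hcross κ b.depthSign 1 (b.alphaLo κ s')) 0 = 1 - 3 * t / 4 := by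
        simpa using congrArg (fun Y : 𝔼 3 ↦ Y 0) hbu
      linarith [ht.1]
  · rw [hY] at hbu
    by_cases h12 : b.alphaHi κ s' ≤ 12
    · have hε5 : ε * (|b.alphaHi κ s'| + 1) ≤ 5 / 6 := by
        rw [abs_of_nonneg (by linarith)]; have := h.eps_le; have := hf.eps_nonneg; nlinarith
      have h6 := b.le_blowUp_pieceHi_one hf hκ ⟨zero_le_one, le_rfl⟩ b.depthSign hq hε5
      have e1 : b.blowUp hcross κ (b.pieceHi hcross κ b.depthSign 1 (b.alphaHi κ s')) 1 = -t := by
        simpa using congrArg (fun Y : 𝔼 3 ↦ Y 1) hbu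
      linarith [ht.1]
    · push Not at h12
      have h1 := b.one_lt_blowUp_pieceHi_one_zero h (by linarith) hq
      have e0 : b.blowUp hcross κ (b.pieceHi hcross κ b.depthSign 1 (b.alphaHi κ s')) 0 = 1 - 3 * t / 4 := by
        simpa using congrArg (fun Y : 𝔼 3 ↦ Y 0) hbu
      linarith [ht.1]
  · have hlt := b.depth_rayLo_lt H ⟨ht.1.le, ht.2⟩ hfar
    rw [← he, Ypt] at hlt
    exact lt_irrefl _ hlt

/-- A point of an upper ray is not the chart value of a general content parameter. [folklore] -/
theorem Ypt_ne_rayHi {s' : ℝ} (hs' : s' ∈ b.contentSet H.cone.spike.κ_pos H.cone.spike.seven_le_gapLo H.cone.spike.seven_le_gapHi)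
    (hg1 : 3 / 4 < b.alphaLo κ s') (hg2 : 3 / 4 < b.alphaHi κ s') {t : ℝ} (ht : t ∈ Ioc (0 : ℝ) (5 / (6 * lam₀))) :
    b.Ypt H.cone s' ≠ b.oS hcross κ b.depthSign + t • (b.blowDown hcross κ (pt3 (1 / 4) 1 0) - b.oS hcross κ b.depthSign) := by
  have h := H.cone
  have hκ := h.spike.κ_pos
  have hf := h.spike.flat
  intro he
  have hbu := congrArg (b.blowUp hcross κ) he
  rw [b.blowUp_rayHi h t] at hbu
  rcases b.content_cases h hs' with ⟨hsc, hα, hq, -, hY⟩ | ⟨hsc, hα, hq, -, hY⟩ | hfar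
  · rw [hY] at hbu
    by_cases h12 : b.alphaLo κ s' ≤ 12
    · have hε5 : ε * (|b.alphaLo κ s'| + 1) ≤ 5 / 6 := by
        rw [abs_of_nonneg (by linarith)]; have := h.eps_le; have := hf.eps_nonneg; nlinarith
      have h6 := b.blowUp_pieceLo_one_le hf hκ ⟨zero_le_one, le_rfl⟩ b.depthSign hq hε5
      have e1 : b.blowUp hcross κ (b.pieceLo hcross κ b.depthSign 1 (b.alphaLo κ s')) 1 = t := by
        simpa using congrArg (fun Y : 𝔼 3 ↦ Y 1) hbu
      linarith [ht.1]
    · push Not at h12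
      have h1 := b.one_lt_blowUp_pieceLo_one_zero h (by linarith) hq
      have e0 : b.blowUp hcross κ (b.pieceLo hcross κ b.depthSign 1 (b.alphaLo κ s')) 0 = 1 - 3 * t / 4 := by
        simpa using congrArg (fun Y : 𝔼 3 ↦ Y 0) hbu
      linarith [ht.1]
  · rw [hY] at hbu
    by_cases h3 : b.alphaHi κ s' ≤ 3
    · rw [b.blowUp_pieceHi_one_of_mem hcross hκ.ne' ⟨by linarith, h3⟩, modelHi] at hbu
      have e0 : b.alphaHi κ s' = 1 - 3 * t / 4 := by simpa using congrArg (fun Y : 𝔼 3 ↦ Y 0) hbu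
      have e1 : 1 - spikeProfile (b.alphaHi κ s') = t := by simpa using congrArg (fun Y : 𝔼 3 ↦ Y 1) hbu
      have hlt := spikeProfile_lt_frac hg2
      have : spikeProfile (b.alphaHi κ s') = (b.alphaHi κ s' - 1 / 4) / (3 / 4) := by
        rw [eq_div_iff (by norm_num)]; linarith
      linarith
    · push Not at h3
      have h1 := b.one_lt_blowUp_pieceHi_one_zero h h3 hq
      have e0 : b.blowUp hcross κ (b.pieceHi hcross κ b.depthSign 1 (b.alphaHi κ s')) 0 = 1 - 3 * t / 4 := by
        simpa using congrArg (fun Y : 𝔼 3 ↦ Y 0) hbu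
      linarith [ht.1]
  · have hlt := b.depth_rayHi_lt H ⟨ht.1.le, ht.2⟩ hfar
    rw [← he, Ypt] at hlt
    exact lt_irrefl _ hlt

include hB hAB in
/-- **The chart value is injective on the extended region** (hence on the content set).
[folklore] -/
theorem Ypt_injOn : InjOn (b.Ypt H.cone) {s | 1 / 4 ≤ b.alphaLo κ s ∧ 1 / 4 ≤ b.alphaHi κ s} := by
  have h := H.cone
  intro s hs s' hs' he
  have h1 : b.knotPt h s = b.knotPt h s' := by
    rw [← b.psiN_symm_Ypt h (b.knotPt_ne_northPole h hB hs.1 hs.2), ← b.psiN_symm_Ypt h (b.knotPt_ne_northPole h hB hs'.1 hs'.2), he]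
  have h2 : b.spikePiece hcross κ b.depthSign 1 s = b.spikePiece hcross κ b.depthSign 1 s' := congrArg Subtype.val h1
  exact b.injOn_spikePiece_Ico h.spike hAB ⟨zero_le_one, le_rfl⟩ (b.mem_Ico_of_region h hs.1 hs.2) (b.mem_Ico_of_region h hs'.1 hs'.2) h2

include hB hAB in
/-- **The scaled chart point is injective on the content set** (`u ∈ [0, 1]`). [folklore] -/
theorem injOn_scalePt {u : ℝ} (hu : u ∈ Icc (0 : ℝ) 1) :
    InjOn (b.scalePt H.cone lam₀ u) (b.contentSet H.cone.spike.κ_pos H.cone.spike.seven_le_gapLo H.cone.spike.seven_le_gapHi) := by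
  have h := H.cone
  have hκ := h.spike.κ_pos
  have hl := H.lam_mem
  set c := u * (1 - lam₀)
  have hc : c ∈ Ico (0 : ℝ) 1 := cParam_mem hl hu
  have hcl : lam₀ ≤ 1 - c := by
    have := hu.2; have := hl.1; nlinarith [hl.2, hu.1]
  set o := b.oS hcross κ b.depthSign
  -- spike scalar bounds
  have hψpos : ∀ {α : ℝ}, α ∈ Icc (3 / 8 : ℝ) (3 / 4) → 0 < spikeScalar c α := fun hα ↦ spikeScalar_pos hc (by linarith [hα.2])
  have hψle : ∀ {α : ℝ}, α ∈ Icc (3 / 8 : ℝ) (3 / 4) → spikeScalar c α ≤ 5 / 6 := fun hα ↦ spikeScalar_le hc hα.1 (by linarith [hα.2])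
  -- the ratio `t = ψ / (1 - c)` lies in `(0, 5/(6 λ₀)]`
  have ht_of : ∀ {α : ℝ}, α ∈ Icc (3 / 8 : ℝ) (3 / 4) → spikeScalar c α / (1 - c) ∈ Ioc (0 : ℝ) (5 / (6 * lam₀)) := fun hα ↦ by
    refine ⟨div_pos (hψpos hα) (by linarith [hc.2]), ?_⟩
    rw [div_le_div_iff₀ (by linarith [hc.2]) (by linarith [hl.1])]
    have := hψle hα
    nlinarith [hl.1]
  -- general content: `scalePt = o + (1 - c) (Y - o)`
  have hgen : ∀ {s : ℝ}, 3 / 4 < b.alphaLo κ s → 3 / 4 < b.alphaHi κ s →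
      b.scalePt h lam₀ u s = o + (1 - c) • (b.Ypt h s - o) := fun h1 h2 ↦ b.scalePt_general h (by linarith) (by linarith)
  -- a spike point equal to a general point puts `Y` on the ray
  have ray_of : ∀ {base : 𝔼 3} {ψ : ℝ} {s' : ℝ}, o + ψ • (base - o) = o + (1 - c) • (b.Ypt h s' - o) →
      b.Ypt h s' = o + (ψ / (1 - c)) • (base - o) := fun {base ψ s'} he ↦ by
    have h1c : (1 - c) ≠ 0 := by linarith [hc.2]
    have := add_left_cancel he
    have h2 : b.Ypt h s' - o = (ψ / (1 - c)) • (base - o) := by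
      rw [div_eq_inv_mul, mul_smul, this, smul_smul, inv_mul_cancel₀ h1c, one_smul]
    rw [← h2]; abel
  intro s hs s' hs' he
  rcases b.contentKind_cases h hs with ⟨hsc, hsα⟩ | ⟨hsc, hsα⟩ | ⟨hg1, hg2⟩ <;>
    rcases b.contentKind_cases h hs' with ⟨hsc', hsα'⟩ | ⟨hsc', hsα'⟩ | ⟨hg1', hg2'⟩
  · -- lower spike / lower spike
    rw [b.scalePt_lowerSpike h (Ioo_subset_Icc_self hsc) ⟨by linarith [hsα.1], hsα.2⟩,
      b.scalePt_lowerSpike h (Ioo_subset_Icc_self hsc') ⟨by linarith [hsα'.1], hsα'.2⟩] at he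
    have h1 := smul_left_injective ℝ (b.baseLo_sub_oS_ne_zero h) (add_left_cancel he)
    have h2 : b.alphaLo κ s = b.alphaLo κ s' :=
      (strictAntiOn_spikeScalar hc).injOn (show b.alphaLo κ s ∈ Iio (1:ℝ) by simp; linarith [hsα.2])
        (show b.alphaLo κ s' ∈ Iio (1:ℝ) by simp; linarith [hsα'.2]) h1
    exact (b.strictMonoOn_alphaLo hκ).injOn (Ioo_subset_Icc_self hsc) (Ioo_subset_Icc_self hsc') h2
  · -- lower spike / upper spike: second blow-up coordinate
    rw [b.scalePt_lowerSpike h (Ioo_subset_Icc_self hsc) ⟨by linarith [hsα.1], hsα.2⟩,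
      b.scalePt_upperSpike h (Ioo_subset_Icc_self hsc') ⟨by linarith [hsα'.1], hsα'.2⟩] at he
    have hbu := congrArg (fun y ↦ b.blowUp hcross κ y 1) he
    simp only [b.blowUp_rayLo h, b.blowUp_rayHi h, pt3_apply_one] at hbu
    linarith [hψpos hsα, hψpos hsα']
  · -- lower spike / general
    rw [b.scalePt_lowerSpike h (Ioo_subset_Icc_self hsc) ⟨by linarith [hsα.1], hsα.2⟩, hgen hg1' hg2'] at he
    exact absurd (ray_of he) (b.Ypt_ne_rayLo H hs' hg1' hg2' (ht_of hsα))
  · rw [b.scalePt_upperSpike h (Ioo_subset_Icc_self hsc) ⟨by linarith [hsα.1], hsα.2⟩,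
      b.scalePt_lowerSpike h (Ioo_subset_Icc_self hsc') ⟨by linarith [hsα'.1], hsα'.2⟩] at he
    have hbu := congrArg (fun y ↦ b.blowUp hcross κ y 1) he
    simp only [b.blowUp_rayLo h, b.blowUp_rayHi h, pt3_apply_one] at hbu
    linarith [hψpos hsα, hψpos hsα']
  · rw [b.scalePt_upperSpike h (Ioo_subset_Icc_self hsc) ⟨by linarith [hsα.1], hsα.2⟩,
      b.scalePt_upperSpike h (Ioo_subset_Icc_self hsc') ⟨by linarith [hsα'.1], hsα'.2⟩] at he
    have h1 := smul_left_injective ℝ (b.baseHi_sub_oS_ne_zero h) (add_left_cancel he)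
    have h2 : b.alphaHi κ s = b.alphaHi κ s' :=
      (strictAntiOn_spikeScalar hc).injOn (show b.alphaHi κ s ∈ Iio (1:ℝ) by simp; linarith [hsα.2])
        (show b.alphaHi κ s' ∈ Iio (1:ℝ) by simp; linarith [hsα'.2]) h1
    exact (b.strictAntiOn_alphaHi hκ).injOn (Ioo_subset_Icc_self hsc) (Ioo_subset_Icc_self hsc') h2
  · rw [b.scalePt_upperSpike h (Ioo_subset_Icc_self hsc) ⟨by linarith [hsα.1], hsα.2⟩, hgen hg1' hg2'] at he
    exact absurd (ray_of he) (b.Ypt_ne_rayHi H hs' hg1' hg2' (ht_of hsα))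
  · rw [hgen hg1 hg2, b.scalePt_lowerSpike h (Ioo_subset_Icc_self hsc') ⟨by linarith [hsα'.1], hsα'.2⟩] at he
    exact absurd (ray_of he.symm) (b.Ypt_ne_rayLo H hs hg1 hg2 (ht_of hsα'))
  · rw [hgen hg1 hg2, b.scalePt_upperSpike h (Ioo_subset_Icc_self hsc') ⟨by linarith [hsα'.1], hsα'.2⟩] at he
    exact absurd (ray_of he.symm) (b.Ypt_ne_rayHi H hs hg1 hg2 (ht_of hsα'))
  · -- general / general
    rw [hgen hg1 hg2, hgen hg1' hg2'] at he
    have h1c : (1 - c) ≠ 0 := by linarith [hc.2]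
    have h1 := smul_right_injective (𝔼 3) h1c (add_left_cancel he)
    have h2 : b.Ypt h s = b.Ypt h s' := sub_left_injective h1
    exact b.Ypt_injOn H hB hAB ⟨by linarith, by linarith⟩ ⟨by linarith, by linarith⟩ h2

include hB hAB in
/-- **The scaling family is injective on the content set** (`u ∈ [0, 1]`). [folklore] -/
theorem injOn_scalePiece {u : ℝ} (hu : u ∈ Icc (0 : ℝ) 1) :
    InjOn (b.scalePiece H.cone lam₀ u) (b.contentSet H.cone.spike.κ_pos H.cone.spike.seven_le_gapLo H.cone.spike.seven_le_gapHi) := by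
  intro s hs s' hs' he
  rw [b.scalePiece_eq_of_mem H.cone lam₀ u hs, b.scalePiece_eq_of_mem H.cone lam₀ u hs'] at he
  exact b.injOn_scalePt H hB hAB hu hs hs' (coe_psiN_symm_injective he)

/-! ### Disjointness from the walls, the shrunk knot and the isotopy -/

include hB in
/-- **The scaling family avoids the walls** (the cone condition). [folklore] -/
theorem scalePiece_ne_spikePiece (hA : A.InNorth) {u : ℝ} (hu : u ∈ Icc (0 : ℝ) 1) {s : ℝ}
    (hs : s ∈ b.contentSet H.cone.spike.κ_pos H.cone.spike.seven_le_gapLo H.cone.spike.seven_le_gapHi) {t : ℝ}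
    (ht : t ∈ Ico b.alo (b.alo + 1)) (hts : t ∉ b.contentSet H.cone.spike.κ_pos H.cone.spike.seven_le_gapLo H.cone.spike.seven_le_gapHi) :
    b.scalePiece H.cone lam₀ u s ≠ b.spikePiece hcross κ b.depthSign 1 t := by
  rw [b.scalePiece_eq_of_mem H.cone lam₀ u hs, scalePt]
  exact b.cone H.cone hA hB hs (b.scaleFn_mem_Icc01 ⟨H.lam_mem.1.le, H.lam_mem.2⟩ hu κ s) ht hts

/-- **The shrunk loop**: the periodisation of the scaling family. [folklore] -/
def shrinkLoop (u : ℝ) : ℝ → 𝔼 4 := periodise b.alo (b.scalePiece H.cone lam₀ u)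

include hB in
/-- **The shrunk loop is a regular loop** for `u ∈ [0, 1]`. [folklore] -/
theorem isRegularLoop_shrinkLoop {u : ℝ} (hu : u ∈ Icc (0 : ℝ) 1) : IsRegularLoop (b.shrinkLoop H u) :=
  (b.isRegularLoop_spikeLoop H.cone.spike ⟨zero_le_one, le_rfl⟩).periodise_of_eqOn_compl
    (b.contDiff_scalePiece_stage H.cone hB lam₀ u) b.seamEps_bounds.1 (b.spikePiece_one_seam H.cone)
    (b.contentSet_subset_seam H.cone) isClosed_Icc (fun _ ht ↦ b.scalePiece_eq_of_not_mem H.cone hB lam₀ u ht)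
    (fun _ hs ↦ b.norm_scalePiece_of_mem H.cone lam₀ u hs)
    (fun _ hs ↦ b.deriv_scalePiece_ne_zero H.cone hB H.lam_mem hu hs)

include hB hAB in
/-- **The scaling family is injective on the fundamental domain** for `u ∈ [0, 1]`. [folklore] -/
theorem injOn_scalePiece_Ico (hA : A.InNorth) {u : ℝ} (hu : u ∈ Icc (0 : ℝ) 1) :
    InjOn (b.scalePiece H.cone lam₀ u) (Ico b.alo (b.alo + 1)) :=
  injOn_Ico_of_eqOn_compl (b.injOn_spikePiece_Ico H.cone.spike hAB ⟨zero_le_one, le_rfl⟩)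
    (fun _ ht ↦ b.scalePiece_eq_of_not_mem H.cone hB lam₀ u ht) (b.injOn_scalePiece H hB hAB hu)
    (fun _ hs _ ht hts ↦ b.scalePiece_ne_spikePiece H hB hA hu hs ht hts)

/-- **The shrunk knot**: the knot of the shrunk loop at `u = 1` (southern content contracted by the
ratio `λ₀` towards the centre `oS`). [folklore] -/
def shrinkKnot (hA : A.InNorth) (hB : B.InSouth) (hAB : Disjoint (range A) (range B)) : Knot :=
  (b.isRegularLoop_shrinkLoop H hB ⟨zero_le_one, le_rfl⟩).toKnot
    (periodise_simple_iff.2 (b.injOn_scalePiece_Ico H hB hAB hA ⟨zero_le_one, le_rfl⟩))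

/-- The shrunk knot on the circle point of parameter `t`. [folklore] -/
theorem coe_shrinkKnot_circlePt (hA : A.InNorth) (hB : B.InSouth) (hAB : Disjoint (range A) (range B)) (t : ℝ) :
    ((b.shrinkKnot H hA hB hAB (circlePt t) : 𝕊 3) : 𝔼 4) = b.shrinkLoop H 1 t :=
  (b.isRegularLoop_shrinkLoop H hB ⟨zero_le_one, le_rfl⟩).coe_toKnot_circlePt _ t

/-- **The spiked knot is isotopic to the shrunk knot** (a smooth family of modifications of the
spiked loop on the content set; isotopy extension). [cite: HirschDT1976, Ch. 8 §1, Thm. 1.3] -/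
theorem isIsotopic_spikeKnot_shrinkKnot (hA : A.InNorth) (hB : B.InSouth) (hAB : Disjoint (range A) (range B)) :
    (b.spikeKnot H.cone.spike hAB).IsIsotopic (b.shrinkKnot H hA hB hAB) :=
  IsRegularLoop.isIsotopic_of_modification (G := b.scalePiece H.cone lam₀)
    (b.isRegularLoop_spikeLoop H.cone.spike ⟨zero_le_one, le_rfl⟩)
    (b.injOn_spikePiece_Ico H.cone.spike hAB ⟨zero_le_one, le_rfl⟩)
    (b.isRegularLoop_shrinkLoop H hB ⟨zero_le_one, le_rfl⟩) (b.injOn_scalePiece_Ico H hB hAB hA ⟨zero_le_one, le_rfl⟩)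
    b.seamEps_bounds.1 (b.spikePiece_one_seam H.cone) (b.contDiff_scalePiece H.cone hB lam₀)
    (b.contentSet_subset_seam H.cone) isClosed_Icc (fun u _ ht ↦ b.scalePiece_eq_of_not_mem H.cone hB lam₀ u ht)
    (b.scalePiece_zero H.cone hB lam₀)
    (fun u _ _ hs ↦ b.norm_scalePiece_of_mem H.cone lam₀ u hs)
    (fun _ hu _ hs ↦ b.deriv_scalePiece_ne_zero H.cone hB H.lam_mem hu hs)
    (fun _ hu ↦ b.injOn_scalePiece H hB hAB hu)
    (fun _ hu _ hs _ ht hts ↦ b.scalePiece_ne_spikePiece H hB hA hu hs ht hts)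

/-- **The rail knot is isotopic to the shrunk knot.** [cite: HirschDT1976, Ch. 8 §1, Thm. 1.3] -/
theorem isIsotopic_railKnot_shrinkKnot (hA : A.InNorth) (hB : B.InSouth) (hAB : Disjoint (range A) (range B)) :
    (b.railKnot hAB).IsIsotopic (b.shrinkKnot H hA hB hAB) :=
  IsAmbientIsotopic.trans_holds (b.isIsotopic_railKnot_spikeKnot H.cone.spike hAB) (b.isIsotopic_spikeKnot_shrinkKnot H hA hB hAB)

omit H

/-! ### The shrink scale hypotheses hold for all small `κ` -/

/-- **Existence of shrink scales**: in normal position (`B` south), for every ratio `λ₀ ∈ (0, 1]`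
there are `ε, r, A'` such that every sufficiently small `κ > 0` is a shrink scale. [folklore] -/
theorem exists_shrinkScale (hB : B.InSouth) (hl : lam₀ ∈ Ioc (0 : ℝ) 1) :
    ∃ ε r A' κ₀ : ℝ, 0 < κ₀ ∧ ∀ κ', 0 < κ' → κ' ≤ κ₀ → b.ShrinkScale hcross ε r A' κ' lam₀ := by
  obtain ⟨ε, r, A', κ₁, hκ₁, hcone⟩ := b.exists_coneScale hcross hB
  have hc1 := hcone κ₁ hκ₁ le_rfl
  have hr : 0 < r := hc1.spike.flat.r_pos
  have hg : 0 < min (r / 2) (min b.gapLo b.gapHi) := lt_min (by linarith) (lt_min b.gapLo_pos b.gapHi_pos)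
  obtain ⟨d, hd, hdepth⟩ := b.exists_depth_farSouth hcross hB hg
  set N := ‖((b.frame hcross : (𝔼 3) ≃L[ℝ] 𝔼 3) : (𝔼 3) →L[ℝ] 𝔼 3)‖
  have hN : 0 ≤ N := norm_nonneg _
  have hL : 0 < 2 + 5 / (2 * lam₀) := by have := hl.1; positivity
  set κ₀ := min κ₁ (d / (8 * (N + 1) * (2 + 5 / (2 * lam₀)))) with hκ₀
  have hκ₀pos : 0 < κ₀ := lt_min hκ₁ (by positivity)
  refine ⟨ε, r, A', κ₀, hκ₀pos, fun κ' hκ' hle ↦ ⟨hcone κ' hκ' (hle.trans (min_le_left _ _)), hl, d, hdepth, ?_⟩⟩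
  have k : κ' ≤ d / (8 * (N + 1) * (2 + 5 / (2 * lam₀))) := hle.trans (min_le_right _ _)
  rw [le_div_iff₀ (by positivity)] at k
  have e : κ' * (8 * (N + 1) * (2 + 5 / (2 * lam₀))) = 2 * (4 * κ' * N * (2 + 5 / (2 * lam₀))) + 8 * κ' * (2 + 5 / (2 * lam₀)) := by ring
  have : 0 < 8 * κ' * (2 + 5 / (2 * lam₀)) := by positivity
  have : 0 ≤ 4 * κ' * N * (2 + 5 / (2 * lam₀)) := by positivity
  linarith

end BandData

end Literature.Topology.FourManifolds
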